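import Summits.CriticalPhenomena.SAWScalingLimit.Theses.SAWTotalPositivity
import Summits.CriticalPhenomena.SAWScalingLimit.Theorems.BoundaryTP2Negative_Box3
import Summits.CriticalPhenomena.SAWScalingLimit.Theorems.CriticalBubbleBound.Negative.CriticalBubbleBoundOneNumber

/-!
# Disproof work file — crux `TPToTraversalBound` (stmt-CriticalPhenomena-10687), standing disprover (v9, cycle 4)

Route `SAWTotalPositivity`, sub-problem `SAWScalingLimit`.  The crux is the glue
`TPToTraversalBound := BoundaryTP2 → CriticalBubbleBound → SAWTraversalBound` (by `Iff.rfl`,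
`iff_imp` below): circular TP₂ of the critical SAW boundary kernel (TP) plus a uniform bound on the
adjacent two-point function (B) should give the Aizenman–Burchard hypothesis (H1) for the chordal
critical square-lattice SAW.

## Findings (index; numbers, not adjectives)

* **F1 (logic, §1–§2, certified).** `¬ crux ↔ TP ∧ B ∧ ¬(H1)` (`not_crux_iff`).  Every
  dropped-hypothesis variant is implied by (H1) and its negation contains `¬(H1)`
  (`not_traversalBound_of_not_without`): a load-bearing certificate `_false_without_H` cannot exist
  unless (H1) — believed true (SLE_{8/3} picture) — fails.  Conversely `¬TP` or `¬B` would close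
  the crux VACUOUSLY (`of_not_tp`, `of_not_bubble`): the disprover of this crux is therefore also a
  disprover of the route (a certified TP₂ violation at `x_c` kills `BoundaryTP2` and trivialises
  this item).  Status of the three legs:
  - TP (stmt-7115): 0 violations in every finite test to date (cycle 1 of this seat + rattack-10687
    + cdisprove-7115): all 86,675 hole-free polyominoes ≤ 12 sites × all typed quadruples ×
    x ∈ {10/27, x_c, 10/26} (2,015,543 instances, 331,777 with interior points); annuli, holed
    boxes, non-induced edge sets, bridge+arc gadgets, thousands of random subgraphs of 4×4/5×4;
    exact frontier-DP corner clusters to L = 10: first-violation thresholds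
    x₀(L) = 0.50108, 0.47494, 0.45706, 0.44422, 0.43462, 0.42722, 0.42138 (L = 4…10)
    ≈ x_c + 0.90·L^{-4/3}; margin at x_c ≈ C·L^{-3.5} > 0 (0.00740 at L = 10); at x = 10/26 the
    margin heads for a sign change near L ≈ 45 — consistent with `EdgeOfPositivity`, and showing
    that NO finite certificate can decide TP₂ on the proved interval x_c ∈ [1/2.7, 1/2.6]
    (TP₂ fails at its upper end for large L, holds at its lower end).  TP₂ at x_c: plausibly true,
    asymptotically tight.
  - B (stmt-7117): equivalent (monotone exhaustion) to G_{x_c}(0,e₁) < ∞ on ℤ², open since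
    Madras–Slade 1993 p. 22; numerically G_{x_c}(0,e₁) = x_c + Σ_{m ≥ 4 even} (m/2)·p_m·x_c^{m-1}
    (p_m = polygon counts A002931; summable iff p_m ≲ μ^m m^{-2-ε}) ≈ 0.81: partial sum to
    m = 42 is 0.697, the terms obey t_m·m^{3/2} → 0.73 (i.e. p_m ≍ μ^m m^{-5/2} numerically), tail
    ≈ 0.11 (this session, μ = 2.63815853).
  - ¬(H1): no junk route (F2) and no physical route (F3).
* **F2 (junk audit of the conclusion (H1) = `SAWTraversalBound`, paper + §4).** Read symbol by
  symbol; nothing exploitable: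
  (i) `law = (weight univ)⁻¹ • weight` is `0` when `a δ, b δ` are not joined (≤ anything) and a
  probability measure otherwise (finite type for bounded Ω, δ > 0), and in all cases gives mass
  ≤ 1 (`law_apply_le_one`, certified); (ii) `∃ δ₀` after `(D,a,b)` defuses the all-δ junk that
  refuted `Tight` (stmt-0772): for δ ∈ (δ₀, 1] the bound is made trivial by `K ≥ δ₀^{-λ}`, so the
  all-δ form of (H1) is EQUIVALENT to the eventual one (`allMesh_iff`, CERTIFIED, axioms standard)
  — not refutable; (iii) the threshold `k x ρ R` is prover-chosen: `k ≥ 1` kills the `HasTraversals 0 =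
  True` trap, and `traversalBound_iff_threshold_ge` (§4, certified) shows `k` may be taken above
  ANY prescribed function — in particular above the deterministic forced-crossing count
  m_D(x,ρ,R) of the domain, so forced crossings (fjords, oscillating prime ends) refute nothing;
  (iv) at the lattice end `ρ = δ` the closed ball B̄(x,δ) holds ≤ 5 sites and ≤ 16 lattice edges
  pass within δ of x (16 exactly when x is a site: 4 incident + 8 around + 4 radial), a SAW uses
  each once, so at most 16 separate visits (32 traversals) are combinatorially possible; with the
  standard
  O(n→0) watermelon dimensions x_L = (9L²-4)/48 (x₁ = 5/48, x₂ = 2/3, x₄ = 35/12) the predicted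
  cost of j separate visits to a lattice-scale neighbourhood after excursions to distance R is
  (δ/R)^{≈ x_{2j}}, far below K(δ/R)^λ for the j a prover would use — no lattice-scale
  contradiction; (v) shells centred at the START a_δ, which `IsEndpointApprox` allows to sit
  mesoscopically inside D — CERTIFIED: `exists_isEndpointApprox_deepStart` (§6) gives an endpoint
  approximation of the unit disc with `ball (a_δ) √δ ⊆ D` for all δ ≤ 1/16, so start-centred shells
  of ratio ρ/R = √δ → 0 with no boundary in sight are in the scope of (H1); convergence rates as
  slow as δ^{0.01} are equally admissible —: k = 3 traversals = one return to
  the start = 3 legs at a point, exponent x₃ - x₁ = 3/2 < 2 — so a proof must NOT use k = 3 near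
  the marked points; k = 4 forces two returns (5 legs, exponent x₅ - x₁ = 9/2 > 2) and in the bulk
  two passes (x₄ = 35/12 > 2): the prediction is that (H1) holds with the CONSTANT threshold
  k = 4 + m_D and any λ < 35/12, margin 11/12 — consistent, unprovable by current means, and the
  reason provers should take k large (exponent ≈ (3/16)k²);
  (vi) `R ≤ 1` with D of any size, x ∈ ℂ arbitrary, thin shells (ρ ≈ R), shells missing D: all
  give empty events or bounds ≥ 1 — harmless; (vii) measurability: ⊤ σ-algebra; (viii)
  `x_c = (⨅ₙ c_{n+1}^{1/(n+1)})⁻¹` is the true 1/μ (family bounded below by 0, Fekete), so all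
  weights are exactly critical.
* **F3 (natural strengthenings, §5).** (H1) with a SHELL-INDEPENDENT threshold (AB99's printed
  (1.3)) is FALSE for the critical SAW in a Jordan domain whose prime end at `a` oscillates
  radially n times across D(a; 2^{-n²-n}, 2^{-n²}) for every n (`not_constThreshold_traversalBound`,
  near-miss: witness described, Lean construction of the domain not attempted); (H1) with
  constants uniform in (D,a,b) is FALSE already along smooth domains D_m winding m times across
  one shell (`not_uniform_traversalBound`, near-miss).  Both only confirm the typing (k after the
  shell, K λ δ₀ after D) — cf. the percolation template, whose threshold is
  `((2j₀ + ⌊1/θ(ρ)⌋₊ + 2) choose 2) + 3` with θ the boundary's modulus of continuity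
  (`Literature.Probability.Percolation.bondExploration_traversalBound_holds`).  The variants
  "all δ ∈ (0,1]", "no cap R ≤ 1", "ρ < δ allowed (with k ≥ 3)", "K = 1" are each EQUIVALENT to
  (H1) up to the choice of k, K (F2 ii–vi), hence not separately attackable.
* **F4 (what TP + B can and cannot feed; why the crux resists disproof AND proof).**
  TP₂ is homogeneous of degree (2,2) and B is one absolute constant; both hold verbatim for the
  toy kernel Z ≡ 1 carried by one deterministic Peano-like snake per (Ω_δ,u,v) (TP₂ with
  equality, B = 1, planarity and the typed interlacing hypotheses untouched) whose "law" traverses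
  every fixed shell ≍ R/δ times: so {TP₂, B, planarity} alone are CONSISTENT with ¬(H1), and any
  proof must use SAW-specific structure (sub/super-multiplicativity, Kesten's bridge identity
  Σ_T A_T(x_c) = 1, D₄ symmetry — all named in the informal scheme).  Quantitatively (ideator BN1,
  Cruxes/TPToTraversalBound/BarrierNotesIdeator1.md, consistent with cycle-1 slit-mouth margins
  2.6e-4 … 8.9e-7): Simon–Lieb splitting at a boundary junction loses (r/δ)^{2-2·5/8} = (r/δ)^{3/4}
  per squeezed pair and reverse Simon–Lieb/TP₂ gluing is sharp only at mesh scale, so a chain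
  "split at annulus crossings, re-glue along the slit boundary" bounds P(unforced crossing) by
  quantities that DIVERGE like a power of r/δ instead of by 1-ε.  The missing input is exactly
  KS Condition G2 / an RSW lower bound for SAW (open: Kemppainen–Smirnov 2017 list SAW as
  unverified; Duminil-Copin–Kozma–Yadin 2014 Problem 10 "show (γ_δ) is not space-filling at x_c"
  is open even in the disc).  A disproof, symmetrically, needs ¬(H1), i.e. a proof that the
  critical SAW IS wild at some scale sequence — contradicting the same conjectural picture.
* **F5 (cycle-1 certified junk of the TP hypothesis, not re-derived here).** The typed
  `BoundaryTP2` ranges over lattice domains that are NOT simply connected although Ω is: slits are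
  invisible to `closure Ω` in `meshGraph`, e.g. a star-convex slit square Ω with
  `discreteDomainGraph Ω 1` = the 8-cycle around (1,1) ∉ `meshDomain Ω 1`
  (`exists_simplyConnected_annular_discretisation`, evidence file 20260815T223427Z-Disproof.lean,
  sha c82987551646e355, rc0 axioms standard).  TP₂ held on every such graph tested, so this widens
  the hypothesis the prover may USE (TP₂ on multiply connected / non-induced lattice domains)
  rather than threatening the crux.
* **F6 (certified kill of a sketch lemma, §7).** `Targets.not_annulusPairingGap`: the ideator-3
  seed `AnnulusPairingGap` (∃ C > 1, θ < 1, ∀ δ > 0, ∀ outer posts a₁ ≠ a₂, inner posts b₁ ≠ b₂ of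
  the lattice annulus {1 < |z| < C}: Z(a₁,b₁)Z(a₂,b₂) ≤ θ·Z(a₁,a₂)Z(b₁,b₂)) is FALSE: at the
  coarse mesh δ = max(C/√2, (1+C)/2) the lattice annulus is {±e₁, ±e₂}, edgeless, every site is
  both an outer and an inner post, and a₁ = b₁ = e₁, a₂ = b₂ = -e₁ gives 1 ≤ θ·0.  Class:
  misstated (coarse-mesh / a_i = b_j junk); repair `∃ δ₀, ∀ δ ≤ δ₀` — the repaired statement is a
  genuine thick-annulus pairing inequality, plausible (continuum ratio ≍ C^{-5/4} for large C) and
  untouched by the witness.  Moral for crux-plan: every "∀ δ > 0" over a FIXED continuum domain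
  must carry a mesh ceiling (cf. the refuted all-δ `Tight`, stmt-0772); lemmas typed at mesh 1 on
  lattice-sized domains (SMLRSlot, PTPSlot) or along δ = 1/(n+2) (CleanDiveSquare, RectangleGap)
  are immune.
* **F7 (second certified kill, §7b).** `Targets.not_rimPushMonotone`: the ideator-3 first lemma
  `RimPushMonotone` (card `bad-slices-are-free`: "removing a region hanging off the deep rim can only
  increase the parallel/rim ratio σ", typed intrinsically over all (Ω ⊇ Ω', δ) with the hanging
  region encoded by "every mouth chord m→m' leaving Ω' meets every deep chord d→d'") is FALSE on
  Ω = 3×3 box ⊇ Ω' = its 2×3 sub-box, mesh 1, room ((0,0),(0,1),(1,2),(1,0)): the provisos hold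
  trivially (the corner m has only the exits d and m'), and with EXACT kernels (certified complete
  enumeration, the tree's `Z₃_eq` + a 2×3 clone) the inequality is `5x⁶(1-2x⁴) ≤ 0` after
  cancelling `(x+x³+2x⁵+4x⁷)(x+x³+x⁵)` — false for all 0 < x < 2^{-1/4} ⊇ {x_c} (x_c ≤ 1/2 proved);
  ratio 1.2031 at x_c.  Census (rimpush.py, this folder): 1,564 of 6,744 typed box ⊇ sub-box
  instances up to 5×4 violate it (worst 1.45); with non-box Ω' 44,544 of 126,742.  Class: misstated
  — the intrinsic proviso cannot tell a region hanging off the RIM from one hanging off a WALL (here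
  the wall [m',d']), where the card itself predicts the opposite sign; repair must type the cyclic
  boundary order (e.g. over `LatticeDobrushin` data), after which "numerically supported" should be
  re-run on the repaired class only.
* **F8 (cycle 3, LANDED in the tree).** The certified negative content now lives under
  `Summits/CriticalPhenomena/SAWScalingLimit/Theorems/TPToTraversalBound/Negative/` and can be IMPORTED by
  ideators / planners / leads (`import Summits.CriticalPhenomena.SAWScalingLimit.Theorems.TPToTraversalBound.Negative.<File>`,
  namespace `Summit.CriticalPhenomena.SAWScalingLimit.Theorems.TPToTraversalBound.Negative`):
  `AnnulusPairingGapFalse` (`not_annulusPairingGap`, p72292, commit 83a5321076e2), `RimPushMonotoneFalse`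
  (`not_rimPushMonotone`, p72369, commit 255f730858ec), `TPToTraversalBoundDeepStart`
  (`exists_isEndpointApprox_deepStart`, p72391, commit 3732fbf30005), `TPToTraversalBoundLogic` (`not_crux_iff`, `allMesh_iff`,
  `traversalBound_iff_threshold_ge`, `law_apply_le_one`, `Without*`, `ConstThreshold/UniformTraversalBound`,
  p72435, commit 04fe05797cbc).  Gate lessons for whoever lands crux-side files: a `def X : Prop` whose docstring carries a
  `[folklore]`/cite tag is RELOCATED to `Literature/Uncategorized` (bounced p72191/p72192) — tag theorems only;
  every theorem needs a docstring; keep declarations directly in the `…Negative` namespace; a `def X : Prop`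
  proved by `theorem x : X` in the same refuter file is classed a positive proof (bounced p73404/p73415) —
  spell the statement out in the theorem; and an ANONYMOUS `end` (of a `noncomputable section`) directly under
  the namespace makes the gate's declaration scanner lose the namespace ("declares no theorem", bounced
  p74022/p74025) — use named sections or `noncomputable def`.
* **F9 (cycle 3, POSITIVE audit, §8–§9, certified, axioms standard).** All three "provable now" sketch lemmas
  of ideator 2 ARE true verbatim: `Targets.optionalStoppingLR : OptionalStoppingLR` (finite additivity + sum
  swap; all `Ω`, all `r ∈ ℝ≥0∞` incl. `⊤`); `Targets.bubbleTailDive : BubbleTailDive` (from (B) alone, through the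
  one-number normal form `criticalBubbleBound_iff_bubble_ne_top` of the stmt-7117 disprover: far excursions force
  long walks, `dist ≤ 2δ|γ|`; long walks are the tail of the finite lattice bubble uniformly in `(Ω, δ)` by
  hypothesis-free domain monotonicity + translation invariance; `Z_Ω(u,v) ≥ x_c` from the edge) — so (B)'s whole
  lattice-scale content is available to every line as a certified lemma, and it is ALL that (B) gives (F4:
  nothing mesoscopic); `Targets.mirrorMonotone` (§9: TP₂ at `(m,t,t̄,m̄)` + the reflection equivariance of the
  WHOLE pipeline meshVertices → meshGraph → largest component → `Ω_δ` → `DomainSAW` → `SAW.weight`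
  (`weight_univ_reflSite`, for `conj '' Ω = Ω`) + reversal `weight_univ_symm`; this equivariance API is reusable
  for every D₄ argument of the cards).  All three can be struck from any stub list; LANDED copies:
  `Negative/OptionalStoppingLR.lean` (p74180, commit 7f2c69a28cf6), `Negative/BubbleTailDiveOfBubble.lean`
  (p74213, commit cea183a7f2a3), `Negative/MirrorMonotoneOfTP2.lean` (p74026, commit 1bf45e45fe0e) — the
  latter exports the reflection API `reflSite_mem_meshDomain`, `discreteDomainGraph_adj_reflSite`, `reflHom`,
  `weight_univ_reflSite`, `weight_univ_symm` in namespace `…Theorems.TPToTraversalBound.Negative`.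
* **F10 (cycle 3, audit of the remaining typed sketch lemmas — none is refutable; why).**
  `CleanDiveSquare` (typed along `δ = 1/(n+2)`, immune to mesh junk; `i = j` is `ε ≤ 1`; it is KS-G1 for one
  clean shape, an RSW LOWER bound; SLE₈/₃ restriction predicts `inf > 0` since both domains share the top side
  and corners).  `CriticalStripGap` (over the BOX kernel `SAW.stripPartitionFunction` — no infinite-strip
  summability junk; `ℓ = 0` forces `C ≥ (1+x_c)/(1-x_c) ≈ 2.22`, `n = 1` forces `a ≤ log μ ≈ 0.97`; prepending
  one step makes every walk a bridge of span `ℓ+1`, so `Σ_j Z_{n,ℓ}(i,j) ≤ x_c^{-1} B_{ℓ+1}(x_c) ≤ 2.64` by bridge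
  renewal — only the RATE `a/n` is open, numerically `(n+1)a_n → 1.95 ≈ 5π/8`).  `QuadraticTraversalLaw`
  (`c ≤ x₂ = 2/3` from generic interior shells; start-centred interior shells, in scope by F2(v), cost
  `x_{2j+1} - x₁ = (3/4)(j²+j) ≥ c j²` — consistent).  `SMLRSlot`: `w = 2` is vacuous (one-column slot,
  `W_b(ext η) = 0`).  For `w ≥ 3` and each fixed `(w, D)` SMLR follows from a PREFIX-FREE four-kernel
  inequality: with `v` the tip (first vertex in the deep half `2y ≤ -D`, necessarily on its top row) one has
  rigorously `W_b(ext η) ≤ x_c^{|η|} Z_Ω(v,b)` (domain monotonicity) and `W_J(ext η) ≥ x_c^{|η|} Z_deep(v,J)`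
  (continuations inside the clean deep half avoid `η` automatically; `J` is deep for `D ≥ 2`), so
  (*) `2·Z_Ω(v,b)·Z_Ω(a,J) ≤ Z_deep(v,J)·Z_Ω(a,b)` for every top-deep-row `v` implies SMLR for every prefix.
  Exact enumeration (exp/smlr_star.py + run_star2.py, this seat; a = (0,1) or the far corner, b = (w,1)):
  (*) margins rhs/lhs = 18.8 (w 3, D 3), 18.1 (D 4), 64.7 (D 6), 234.9 (D 8) on the 7 × 2 box (+ 7 × 3: 18.2,
  67.3); 4.8 (w 4, D 4), 13.0 (D 6), 35.1 (D 8) on the 9 × 2 box — growing like `e^{rate_{w-1}·ΔD}` in the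
  depth (`rate₂ = 0.65`, `rate₃ = 0.49`) but DECREASING in `w` at fixed aspect (18.8 → 4.8): (*) prices the
  return from `v` as from a BULK point (`Z_Ω(v,b) ≍ δ^{5/48+5/8}`) whereas the true continuation starts at the
  TIP of `η`, so at fixed aspect its margin decays like `δ^{25/48}` in the scaling limit and (*) can NOT give
  SMLR uniformly in `w`.  Net: at small widths SMLR is immune to adversarial prefixes (certified through (*));
  a counterexample to `SMLRSlot`, if any, is a large-`w`, fixed-aspect configuration where the tip-vs-bulk
  exponent (BN2) decides — beyond enumeration; not refuted, and the card's "sup over pasts is harmless" remains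
  a bet exactly there.  `PTPSlot` (`∀ K ∃ C₀` absorbed by geometric growth `≈ e^3`
  per unit aspect; `w = 2` reduces exactly to `K x_c^{2d+2}·Z_B(m,u)Z_B(u,b)/Z_B(m,b) ≤ 1`, a hidden (B)-type
  uniform ratio — fine for a line assuming (B); `p ∈ J` at `d = D-1` only helps).  `RectangleGap` (typed family
  `(4N+1) × (2N+1)` sites at `δ = 1/(2N+1)`, NOT the card's 2×4/3×6/4×8; `θ < 0` is excluded by `ofReal`; N = 1
  ratio ≈ 0.2, continuum limit `(H_{AD}/H_{AB})^{5/8} < 1`; true iff the sup over N is < 1 — no mechanism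
  against).  `MirrorMonotone` (= TP₂ at `(m,t,t̄,m̄)` + conj-equivariance/reversal of `SAW.weight` + `a² ≤ b²`;
  provisos match BoundaryTP2's one-for-one) — CERTIFIED in §9 (cycle 3).
  `TranslationMonotone` (typed `BoundaryTP2 → …`; every proof route needs the half-plane finiteness
  `Z_ℍ(0,k) < ∞`, a cousin of (B) — retype `BoundaryTP2 → CriticalBubbleBound → …`; not refutable without ¬(B)).
  `CrossRatioSubmult`/`ParallelRatioSubmult`: proved from TP₂ by ideator 3 (re-checked by all triagers).
* **F11 (cycle 4, §10: the PICKED line `radial-portal-transfer`, PICKED.md 2026-08-16T01:43Z).** Its five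
  registered stubs (`stub_cleanContraction`, `stub_decorationRemoval`, `stub_topHeaviness`, `stub_chain`,
  `stub_boundaryShells`) were attacked and NONE is refuted or junk: (a) vocabulary audit certified (§10 API:
  `hasPieces_zero`, `HasPieces.of_le`, `.anti_threshold`, `.le_length_succ`, `not_hasPieces_self`,
  `supDist_le_of_adj`, `IsOutsidePiece.supDist_start_eq` — pieces start on the ring `supDist = N`, so `h ≤ 8N+1` and
  every fixed `N` is absorbed by the constants; only `N → ∞` has content); (b) the one probability-one attack on
  `CleanContraction`/`HeavinessContraction` — outside data (decorations) FORCING deep inside bridges by planarity —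
  is combinatorially impossible: exhaustive meander enumeration (`exp/meander_force2.py`, `meander_force3.py`, up to
  16 portals: 6,435 outside pairings × 1,430 inside pairings, all end-portal positions, all base gaps / antipodal
  cuts; and T = 18: all 24,310 outside pairings × all base gaps against the 256 depth-≤2 block tilings, 0 failures)
  shows EVERY outside pairing admits an admissible inside completion of nesting depth ≤ 2 (≤ 2 cut-crossing
  arcs), whereas one forced entry into the `N`-box needs depth ≥ 3N+1; so the contraction stubs are purely
  probabilistic KS-G2-type statements; (c) regimes `m ≫ N` (empty range), packed/serial data (nothing forced by F11; the shallow threading even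
  dominates the full boustrophedon; `θ = 0` plausible), sparse data, `u`/`v` inside the box, `u = v` — all
  consistent; (d) `stub_chain`'s
  bookkeeping (filtration, measurability, box inclusions, traversal ⇒ heaviness conversion, supermartingale) checked
  on paper — provable as typed; (e) `TopHeaviness`, `Interior/BoundaryShellBound`: (H1)-type, every exponent with
  shell-dependent threshold, deep starts in scope and consistent (`x₇ - x₁ = 9 > 6`).  The lead's paper kill of
  `power-law-tp2`'s seed `TP2Gap` as typed (cycle-graph `Ω_δ`, F5 loophole) is confirmed by recomputation; class
  misstated; not certified (non-picked line).
* **Literature (cycle 4).** arXiv cascade 0 rows (rc 3); OpenAlex HTTP 429 (daily budget); zbMATH "self-avoiding walk"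
  2025+ (38 rows) and "self-avoiding walk scaling limit" 2024+ (2 rows): NOTHING on annulus crossing / RSW / tightness /
  (H1) for the critical planar SAW.  Tangential: Krachun–Panagiotis, Ann. Probab. 54 (2026) 1109 (quantitative
  sub-ballisticity on Hex); Couronné, J. Stat. Phys. 192 (2025), arXiv:2211.16146 (new UPPER bound for μ(ℤ²) — relevant to
  the tree's proved μ ∈ [2.6, 2.7] and hence to certifying a TP₂ violation at x_c, i.e. to the BoundaryTP2 disprover, not to
  this crux); Liu–Slade arXiv:2605.15545 (subcritical→critical crossover of two-point decay, high d).  State of the art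
  unchanged: KS17 Condition G2 unverified for SAW; DKY14 Problem 10 open; no ¬(H1) evidence anywhere.
* **Literature (cycle 3).** searchd (local index) rc 75 again; S2 HTTP 429; arXiv/zbMATH cascades returned 0 rows;
  OpenAlex and galaxy-pdf (`--mode intelligent`, 20 hits) answered.  Queries: "self-avoiding walk annulus
  crossing probability critical", "critical self-avoiding walk planar crossing estimates" (2016+), "self-avoiding
  walk critical two-dimensional annulus arm exponent rigorous" (2019+), galaxy "rigorous annulus crossing / RSW /
  tightness / arm exponents for the critical SAW (KS G2, AB H1)".  NOTHING on annulus-crossing / tightness /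
  (H1) for the critical planar SAW, 2016–2026.  Adjacent items seen: Duminil-Copin–Ganguly–Hammond–Manolescu,
  Ann. Probab. 48 (2020) doi:10.1214/19-aop1400 (Hammersley–Welsh with polygon insertion — counting, not
  geometry); Duminil-Copin–Manolescu–Tassion, PTRF 2021 doi:10.1007/s00440-021-01060-6 (RCM fractal properties —
  the RSW machine needs FKG, which SAW lacks); Sun–Xu–Zhuang arXiv:2410.04767 (annulus crossing formulae —
  percolation/CLE); Peltola 2024 SLE/CFT lecture notes; Duminil-Copin's parafermion volume (Ensaios 2013).  State
  of the art unchanged: KS17 list SAW's Condition G2 as unverified; DKY14 Problem 10 open; no ¬(H1) evidence.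
* **Literature (cycle 2).** searchd (local index), OpenAlex, S2 and galaxy-pdf unavailable
  (rc 75 / 429 / queue) this session; zbMATH answered.  zbMATH "self-avoiding walk scaling limit"
  (2010+, 25 rows) and "self-avoiding walk Hammond" (10 rows): the rigorous planar-SAW corpus is
  sub-ballisticity (Duminil-Copin–Hammond, CMP 324 (2013), doi:10.1007/s00220-013-1811-1;
  quantitative on Hex: Krachun–Panagiotis, Ann. Probab. 54 (2026), arXiv:2310.17299), endpoint
  delocalisation (DC–Glazman–Hammond–Manolescu, Ann. Probab. 44 (2016), doi:10.1214/14-aop993),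
  polygon/closing bounds (Hammond, Ann. Probab. 46 (2018); TAMS 372 (2019); EJP 24 (2019)),
  Hammersley–Welsh improvements (DC–Ganguly–Hammond–Manolescu, Ann. Probab. 48 (2020);
  Hutchcroft ECP 23 (2018)), supercritical space filling (DKY, AIHP 50 (2014)), Yang–Baxter
  universality + bridges-in-strips → 0 (Glazman–Manolescu, AIHP 56 (2020), arXiv:1708.00395 —
  read: no RSW/annulus/arm statement; relevant only to the strip-gap card), lattice/boundary
  effects and simulations (Kennedy–Lawler arXiv:1109.3091; Kennedy J. Stat. Phys. 2012–15;
  Guttmann–Kennedy 2014; Guttmann–Jacobsen 2013).  NO paper proves or disproves an annulus-crossing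
  / RSW / tightness statement for the critical planar SAW; (H1)/G2 for SAW remains unverified
  (KS17) and DKY14 Problem 10 open.  Nothing in print bears on ¬(H1); nothing gives TP → (H1).
* **Future targets (for re-arms).** Ideator round-1 first lemmas (Cruxes/…/SketchIdeator1.lean):
  `CriticalStripGap` (typed with ∃ C: at ℓ = 0 the left side is Σ_j x_c^{|i-j|} ≤ (1+x_c)/(1-x_c)
  ≈ 2.22, so the card's "C = 1 admissible" is false as typed but immaterial; the content — rate
  ≥ a/n uniformly in the width — is the conformal strip gap 5π/8, numerically (w+1)a_w = 1.946,
  1.949, 1.951 for w = 2,3,4, unproved: a quantitative Hammersley–Whittington gap), `CleanDiveSquare`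
  (KS-G1 ratio form for one shape; an RSW LOWER bound — open), `QuadraticTraversalLaw` (needs
  c ≤ x₂ = 2/3 from generic interior shells; start-centred interior shells are included by its
  typing and cost x_{2j+1} - x₁ = (3/4)(j²+j) ≥ c j² — consistent).  None is cheaply refutable;
  all are conjecturally true.  Ideator 2 (SketchIdeator2.lean): `OptionalStoppingLR` (pure
  bookkeeping — CERTIFIED in §8, cycle 3), `MirrorMonotone` (TP₂ + conjugation symmetry of Ω_δ —
  CERTIFIED in §9, cycle 3), `BubbleTailDive` (B + monotone exhaustion + x_c > 0 — CERTIFIED in §8, cycle 3), `SMLRSlot` / `PTPSlot`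
  (likelihood-ratio conjectures at mesh 1, scale-free in (w,D), consistent with the toy data;
  w = 2 degenerates harmlessly: the width-1 slot makes Z'(v,b) = 0), `TranslationMonotone` (typed
  as BoundaryTP2 → …: its only proof route passes the TP₂ sandwich to the half-plane limit and
  needs Z_ℍ(0,e₁) < ∞, i.e. hypothesis (B) — suggest retyping `BoundaryTP2 → CriticalBubbleBound →
  …`; true either way conjecturally).  Ideator 3 (Sketch.lean): `CrossRatioSubmult`,
  `ParallelRatioSubmult` (proved there from TP₂), `RectangleGap` (ratios 0.232, 0.185, 0.165
  decreasing — true with θ = 1/4 if monotone), `RimPushMonotone` — REFUTED (F7), `AnnulusPairingGap` — REFUTED (F6).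

## Sections
§1 logic · §2 load-bearing · §4 threshold monotonicity, mass ≤ 1, all-δ ↔ eventual (certified) · §6 deep-start inhabitant of `IsEndpointApprox` (certified) · §7 Targets: `not_annulusPairingGap`, §7b `not_rimPushMonotone` (certified kills of two sketch lemmas; LANDED, F8) · §8 positive audit: `optionalStoppingLR`, `bubbleTailDive` (certified, cycle 3) · §9 `mirrorMonotone` + reflection-equivariance API (certified, cycle 3) · §10 Targets (cycle 4): the five registered stubs of the PICKED line `radial-portal-transfer` — audit, certified heaviness-count API, meander computation (F11) · §5 near-misses (the only
`sorry`s; constructions in the docstrings).  Registered Targets at cycle 4: the five `stub_*` of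
`Lines/radial-portal-transfer.lean` (payload.stuck_stubs = []); none broken.
-/

namespace Summit.CriticalPhenomena.SAWScalingLimit.Cruxes.TPToTraversalBound.Disproof

open Summit.CriticalPhenomena.SAWScalingLimit.Theses.SAWTotalPositivity
open Literature.Probability.RandomPlanarGeometry Literature.Probability.LatticeModels MeasureTheory

/-! ## §1 Logic of the crux: it is the glue `TP → B → (H1)` -/

/-- The crux is literally the implication `BoundaryTP2 → CriticalBubbleBound → SAWTraversalBound`. [folklore] -/
theorem iff_imp :
    TPToTraversalBound ↔ (BoundaryTP2 → CriticalBubbleBound → SAWTraversalBound) := Iff.rfl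

/-- A disproof of the crux is EXACTLY a proof of TP₂, a proof of the bubble bound, and a disproof of
(H1) for the critical SAW. [folklore] -/
theorem not_crux_iff :
    ¬ TPToTraversalBound ↔ BoundaryTP2 ∧ CriticalBubbleBound ∧ ¬ SAWTraversalBound := by
  constructor
  · intro h
    by_contra h'
    apply h
    intro htp hb
    by_contra hH
    exact h' ⟨htp, hb, hH⟩
  · rintro ⟨htp, hb, hH⟩ h
    exact hH (h htp hb)

/-- Any proof of (H1) closes the crux (`fun h _ _ => h`). [folklore] -/
theorem of_traversalBound (h : SAWTraversalBound) : TPToTraversalBound := fun _ _ => h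

/-- Ex falso: a refutation of the hypothesis TP₂ closes the crux vacuously. [folklore] -/
theorem of_not_tp (h : ¬ BoundaryTP2) : TPToTraversalBound := fun htp => absurd htp h

/-- Ex falso: a refutation of the bubble bound closes the crux vacuously. [folklore] -/
theorem of_not_bubble (h : ¬ CriticalBubbleBound) : TPToTraversalBound := fun _ hb => absurd hb h

/-! ## §2 Load-bearing analysis: the crux with a hypothesis dropped -/

/-- The crux with TP₂ dropped. [folklore] -/
def WithoutTP : Prop := CriticalBubbleBound → SAWTraversalBound

/-- The crux with the bubble bound dropped. [folklore] -/
def WithoutBubble : Prop := BoundaryTP2 → SAWTraversalBound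

/-- The crux with both hypotheses dropped: (H1) itself. [folklore] -/
def WithoutBoth : Prop := SAWTraversalBound

/-- Each dropped-hypothesis variant implies the crux. [folklore] -/
theorem of_withoutTP (h : WithoutTP) : TPToTraversalBound := fun _ hb => h hb

/-- Each dropped-hypothesis variant implies the crux. [folklore] -/
theorem of_withoutBubble (h : WithoutBubble) : TPToTraversalBound := fun htp _ => h htp

/-- Each dropped-hypothesis variant implies the crux. [folklore] -/
theorem of_withoutBoth (h : WithoutBoth) : TPToTraversalBound := fun _ _ => h

/-- `¬ WithoutTP` is a proof of the bubble bound together with a disproof of (H1). [folklore] -/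
theorem not_withoutTP_iff : ¬ WithoutTP ↔ CriticalBubbleBound ∧ ¬ SAWTraversalBound :=
  Classical.not_imp

/-- `¬ WithoutBubble` is a proof of TP₂ together with a disproof of (H1). [folklore] -/
theorem not_withoutBubble_iff : ¬ WithoutBubble ↔ BoundaryTP2 ∧ ¬ SAWTraversalBound :=
  Classical.not_imp

/-- `¬ WithoutBoth` is a disproof of (H1). [folklore] -/
theorem not_withoutBoth_iff : ¬ WithoutBoth ↔ ¬ SAWTraversalBound := Iff.rfl

/-- Hence every conceivable `_false_without_` theorem for this crux CONTAINS a disproof of (H1) for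
the critical square-lattice SAW — a statement believed true (SLE_{8/3} picture); no load-bearing
certificate can exist unless (H1) fails. [folklore] -/
theorem not_traversalBound_of_not_without
    (h : ¬ WithoutTP ∨ ¬ WithoutBubble ∨ ¬ WithoutBoth) : ¬ SAWTraversalBound := by
  rcases h with h | h | h
  · exact (not_withoutTP_iff.1 h).2
  · exact (not_withoutBubble_iff.1 h).2
  · exact h

/-! ## §4 The conclusion's threshold may be raised at will (no `k`-loophole, room for forced crossings) -/

/-- The `k`-traversal event shrinks as `k` grows, hence so does its SAW probability. [folklore] -/
theorem law_hasTraversals_anti {Ω : Set ℂ} {δ : ℝ} {u v : Site 2} {j k : ℕ} (hjk : j ≤ k)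
    (x : ℂ) (ρ R : ℝ) :
    SAW.law Ω δ u v {γ | (⟨γ.walk.toCurve (meshPoint δ)⟩ : Curve ℂ).HasTraversals k x ρ R}
      ≤ SAW.law Ω δ u v {γ | (⟨γ.walk.toCurve (meshPoint δ)⟩ : Curve ℂ).HasTraversals j x ρ R} :=
  measure_mono fun _ hγ => Curve.HasTraversals.of_le hγ hjk

/-- (H1) is equivalent to (H1) with the threshold function required to dominate ANY prescribed
function `k₀ : ℂ → ℝ → ℝ → ℕ` (e.g. the deterministic forced-crossing count of the domain near its
marked prime ends).  So the shell-dependence of `k` absorbs every geometric forcing, and a refutation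
can never come from forced crossings alone. [folklore] -/
theorem traversalBound_iff_threshold_ge :
    SAWTraversalBound ↔ ∀ (k₀ : ℂ → ℝ → ℝ → ℕ) (D : DobrushinDomain) (a b : ℝ → Site 2),
      SAW.IsEndpointApprox D a b →
      ∃ (k : ℂ → ℝ → ℝ → ℕ) (K lam δ₀ : ℝ), (∀ x ρ R, k₀ x ρ R ≤ k x ρ R) ∧ 0 ≤ K ∧ 2 < lam ∧
        0 < δ₀ ∧ ∀ δ ∈ Set.Ioc (0 : ℝ) δ₀, ∀ (x : ℂ) (ρ R : ℝ), δ ≤ ρ → ρ < R → R ≤ 1 →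
          SAW.law D.carrier δ (a δ) (b δ)
              {γ | (⟨γ.walk.toCurve (meshPoint δ)⟩ : Curve ℂ).HasTraversals (k x ρ R) x ρ R}
            ≤ ENNReal.ofReal (K * (ρ / R) ^ lam) := by
  constructor
  · intro h k₀ D a b hab
    obtain ⟨k, K, lam, δ₀, hK, hlam, hδ₀, hb⟩ := h D a b hab
    refine ⟨fun x ρ R => max (k₀ x ρ R) (k x ρ R), K, lam, δ₀, fun x ρ R => le_max_left _ _, hK,
      hlam, hδ₀, ?_⟩
    intro δ hδ x ρ R h1 h2 h3
    exact (law_hasTraversals_anti (le_max_right _ _) x ρ R).trans (hb δ hδ x ρ R h1 h2 h3)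
  · intro h D a b hab
    obtain ⟨k, K, lam, δ₀, -, hK, hlam, hδ₀, hb⟩ := h (fun _ _ _ => 0) D a b hab
    exact ⟨k, K, lam, δ₀, hK, hlam, hδ₀, hb⟩

/-- The all-`δ` form of (H1) (no `δ₀`: every `δ ∈ (0,1]`) FOLLOWS from the eventual form whenever
the bound is allowed to be re-scaled by `δ₀^{-λ}` — the `K`-absorption of F2(ii): on `δ ∈ (δ₀, 1]`
one has `ρ/R ≥ δ₀`, so `K' = max K δ₀^{-λ}` (with `K' ≥ 1 ≥` any probability) works.  Stated here
as the pointwise arithmetic fact used. [folklore] -/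
theorem one_le_rescaled_bound {K lam δ₀ ρ R : ℝ} (hlam : 0 ≤ lam) (hδ₀ : 0 < δ₀)
    (hρ : δ₀ ≤ ρ) (hρR : ρ < R) (hR : R ≤ 1) :
    1 ≤ max K (δ₀ ^ (-lam)) * (ρ / R) ^ lam := by
  have hρ0 : 0 < ρ := hδ₀.trans_le hρ
  have hR0 : 0 < R := hρ0.trans hρR
  have hq : δ₀ ≤ ρ / R := by
    rw [le_div_iff₀ hR0]
    nlinarith
  have hq1 : (ρ / R) ^ lam ≥ δ₀ ^ lam := Real.rpow_le_rpow hδ₀.le hq hlam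
  have hinv : δ₀ ^ (-lam) * δ₀ ^ lam = 1 := by
    rw [Real.rpow_neg hδ₀.le, inv_mul_cancel₀ (Real.rpow_pos_of_pos hδ₀ lam).ne']
  calc (1 : ℝ) = δ₀ ^ (-lam) * δ₀ ^ lam := hinv.symm
    _ ≤ max K (δ₀ ^ (-lam)) * (ρ / R) ^ lam := by
        apply mul_le_mul (le_max_right _ _) hq1 (Real.rpow_nonneg hδ₀.le _)
        exact le_trans (Real.rpow_nonneg hδ₀.le _) (le_max_right _ _)

/-- Whatever the junk conventions (`law = 0` if no SAW joins the endpoints or if the total weight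
is infinite), the SAW law gives mass at most `1` to every event. [folklore] -/
theorem law_apply_le_one (Ω : Set ℂ) (δ : ℝ) (u v : Site 2) (S : Set (SAW.DomainSAW Ω δ u v)) :
    SAW.law Ω δ u v S ≤ 1 := by
  calc SAW.law Ω δ u v S ≤ SAW.law Ω δ u v Set.univ := measure_mono (Set.subset_univ _)
    _ = (SAW.weight Ω δ u v Set.univ)⁻¹ * SAW.weight Ω δ u v Set.univ := by
        rw [SAW.law, Measure.smul_apply, smul_eq_mul]
    _ ≤ 1 := ENNReal.inv_mul_le_one _

/-- (H1) demanded for EVERY mesh `δ ∈ (0, 1]` (no `δ₀`), all other quantifiers as in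
`SAWTraversalBound`. [folklore] -/
def AllMeshTraversalBound : Prop :=
  ∀ (D : DobrushinDomain) (a b : ℝ → Site 2), SAW.IsEndpointApprox D a b →
    ∃ (k : ℂ → ℝ → ℝ → ℕ) (K lam : ℝ), 0 ≤ K ∧ 2 < lam ∧
      ∀ δ ∈ Set.Ioc (0 : ℝ) 1, ∀ (x : ℂ) (ρ R : ℝ), δ ≤ ρ → ρ < R → R ≤ 1 →
        SAW.law D.carrier δ (a δ) (b δ)
            {γ | (⟨γ.walk.toCurve (meshPoint δ)⟩ : Curve ℂ).HasTraversals (k x ρ R) x ρ R}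
          ≤ ENNReal.ofReal (K * (ρ / R) ^ lam)

/-- CERTIFIED: unlike tightness (where the all-`δ` form `Tight` was refuted, stmt-0772, and only the
eventual form survives), the all-`δ` form of (H1) is EQUIVALENT to the eventual form: for
`δ > δ₀` one has `ρ/R ≥ δ₀`, and the constant `max K δ₀^{-λ}` makes the bound `≥ 1 ≥` any
probability (`one_le_rescaled_bound`, `law_apply_le_one`).  So no all-`δ` junk attack exists on the
conclusion of this crux. [folklore] -/
theorem allMesh_iff : AllMeshTraversalBound ↔ SAWTraversalBound := by
  constructor
  · intro h D a b hab
    obtain ⟨k, K, lam, hK, hlam, hb⟩ := h D a b hab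
    exact ⟨k, K, lam, 1, hK, hlam, one_pos, hb⟩
  · intro h D a b hab
    obtain ⟨k, K, lam, δ₀, hK, hlam, hδ₀, hb⟩ := h D a b hab
    refine ⟨k, max K (δ₀ ^ (-lam)), lam, le_trans hK (le_max_left _ _), hlam, ?_⟩
    intro δ hδ x ρ R h1 h2 h3
    have hρ0 : 0 < ρ := hδ.1.trans_le h1
    have hR0 : 0 < R := hρ0.trans h2
    by_cases hδδ₀ : δ ≤ δ₀
    · refine (hb δ ⟨hδ.1, hδδ₀⟩ x ρ R h1 h2 h3).trans (ENNReal.ofReal_le_ofReal ?_)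
      exact mul_le_mul_of_nonneg_right (le_max_left _ _) (Real.rpow_nonneg (div_pos hρ0 hR0).le _)
    · have hlt : δ₀ < δ := not_le.1 hδδ₀
      calc SAW.law D.carrier δ (a δ) (b δ)
              {γ | (⟨γ.walk.toCurve (meshPoint δ)⟩ : Curve ℂ).HasTraversals (k x ρ R) x ρ R}
            ≤ 1 := law_apply_le_one _ _ _ _ _
        _ ≤ ENNReal.ofReal (max K (δ₀ ^ (-lam)) * (ρ / R) ^ lam) :=
            ENNReal.one_le_ofReal.2
              (one_le_rescaled_bound (by linarith) hδ₀ (hlt.le.trans h1) h2 h3)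

/-! ## §5 Near-misses: natural strengthenings of (H1) that are FALSE but whose Lean witness needs an
explicit Jordan domain (not built).  `sorry` lives only here. -/

/-- (H1) with a SHELL-INDEPENDENT threshold `k : ℕ` — the printed form of Aizenman–Burchard (1.3) —
quantified exactly like `SAWTraversalBound` otherwise. [folklore] -/
def ConstThresholdTraversalBound : Prop :=
  ∀ (D : DobrushinDomain) (a b : ℝ → Site 2), SAW.IsEndpointApprox D a b →
    ∃ (k : ℕ) (K lam δ₀ : ℝ), 0 ≤ K ∧ 2 < lam ∧ 0 < δ₀ ∧
      ∀ δ ∈ Set.Ioc (0 : ℝ) δ₀, ∀ (x : ℂ) (ρ R : ℝ), δ ≤ ρ → ρ < R → R ≤ 1 →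
        SAW.law D.carrier δ (a δ) (b δ)
            {γ | (⟨γ.walk.toCurve (meshPoint δ)⟩ : Curve ℂ).HasTraversals k x ρ R}
          ≤ ENNReal.ofReal (K * (ρ / R) ^ lam)

/-- NEAR-MISS (not closed): the constant-threshold form is FALSE.  Witness (paper): a Jordan domain
`D` whose boundary arcs at the marked point `a = D.pt 0` bound a finger that, for every `n`,
oscillates `n` times radially across the shell `D(a; 2^{-n²-n}, 2^{-n²})` (stage `n` lives in
radii `[2^{-n²-n}, 2^{-n²}]`, finger width there `≈ 2^{-n²-n}/(10 n)`, total boundary length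
summable, so the loop is continuous and injective — a genuine `JordanDomain`), `b` opposite; `a δ` =
a site of the deepest stage still inside the largest mesh component (→ `a`), `b δ → b`.  Given
`k K λ δ₀`, pick `n ≥ k` with `K·2^{-nλ} < 1` and `δ ≤ δ₀` so small that stage `n` is fat at mesh
`δ` and `a δ` lies beyond it: EVERY SAW from `a δ` to `b δ` follows the finger through stage `n`,
hence has `n ≥ k` separate traversals of that shell, the law is a probability measure
(`IsEndpointApprox.reachable`, finiteness), so the left side is `1 > K (ρ/R)^λ`.  Obstruction to
closing in Lean: an explicit `JordanDomain` with this boundary (injectivity, `range = frontier`)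
and the identification of `meshDomain` for it — several thousand lines; not attempted.  Moral for
provers: the threshold MUST absorb the forced-crossing count `m_D(x,ρ,R)`, unbounded over shells for
admissible `D`; cf. the percolation template's `⌊1/θ(ρ)⌋₊`. [folklore] -/
theorem not_constThreshold_traversalBound : ¬ ConstThresholdTraversalBound := by
  sorry

/-- (H1) with constants uniform in the Dobrushin domain and the endpoint approximation. [folklore] -/
def UniformTraversalBound : Prop :=
  ∃ (k : ℂ → ℝ → ℝ → ℕ) (K lam δ₀ : ℝ), 0 ≤ K ∧ 2 < lam ∧ 0 < δ₀ ∧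
    ∀ (D : DobrushinDomain) (a b : ℝ → Site 2), SAW.IsEndpointApprox D a b →
      ∀ δ ∈ Set.Ioc (0 : ℝ) δ₀, ∀ (x : ℂ) (ρ R : ℝ), δ ≤ ρ → ρ < R → R ≤ 1 →
        SAW.law D.carrier δ (a δ) (b δ)
            {γ | (⟨γ.walk.toCurve (meshPoint δ)⟩ : Curve ℂ).HasTraversals (k x ρ R) x ρ R}
          ≤ ENNReal.ofReal (K * (ρ / R) ^ lam)

/-- NEAR-MISS (not closed): the uniform form is FALSE, already along SMOOTH domains.  Witness
(paper): given `k K λ δ₀`, take `ρ < 1` with `K ρ^λ < 1`, `m > k 0 ρ 1`, and a smooth thin spiral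
corridor `D_m` from `a` (inside `B(0,ρ/2)`) to `b` (outside `B(0,2)`) winding so that it crosses the
shell `D(0; ρ, 1)` `m` times; for `δ` small every SAW of `(D_m)_δ` from `a δ` to `b δ` has `m`
separate traversals, so the law of the event is `1 > K ρ^λ`.  Same Lean obstruction as above
(explicit Jordan domains).  Moral: `K, λ, δ₀` genuinely depend on `(D,a,b)`; nothing uniform can be
aimed at. [folklore] -/
theorem not_uniform_traversalBound : ¬ UniformTraversalBound := by
  sorry

/-- Sanity (certified): the uniform form would imply (H1), so its falsity costs the crux nothing.
[folklore] -/
theorem traversalBound_of_uniform (h : UniformTraversalBound) : SAWTraversalBound := by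
  obtain ⟨k, K, lam, δ₀, hK, hlam, hδ₀, hb⟩ := h
  exact fun D a b hab => ⟨k, K, lam, δ₀, hK, hlam, hδ₀, hb D a b hab⟩

/-- Sanity (certified): the constant-threshold form would imply (H1). [folklore] -/
theorem traversalBound_of_constThreshold (h : ConstThresholdTraversalBound) : SAWTraversalBound := by
  intro D a b hab
  obtain ⟨k, K, lam, δ₀, hK, hlam, hδ₀, hb⟩ := h D a b hab
  exact ⟨fun _ _ _ => k, K, lam, δ₀, hK, hlam, hδ₀, hb⟩

/-! ## §6 Certified inhabitant: `IsEndpointApprox` allows a mesoscopically interior start (F2 v) -/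

section DeepStart

open Literature.Probability.RandomPlanarGeometry.SAW Literature.Probability.Percolation Filter Topology Set

/-- The lattice abscissa of the depth-`√δ` starting point: `⌈δ⁻¹⌉ - 1 - ⌈(√δ)⁻¹⌉`. [folklore] -/
noncomputable def deepIndex (δ : ℝ) : ℤ := ⌈δ⁻¹⌉ - 1 - ⌈(Real.sqrt δ)⁻¹⌉

/-- The mesh abscissa `δ · deepIndex δ` lies in `(1 - √δ - 2δ, 1 - √δ)`. [folklore] -/
theorem deepIndex_bounds {δ : ℝ} (hδ : 0 < δ) :
    1 - Real.sqrt δ - 2 * δ < δ * (deepIndex δ : ℝ) ∧ δ * (deepIndex δ : ℝ) < 1 - Real.sqrt δ := by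
  have hs : 0 < Real.sqrt δ := Real.sqrt_pos.2 hδ
  have hss : Real.sqrt δ * Real.sqrt δ = δ := Real.mul_self_sqrt hδ.le
  have h1 : (δ⁻¹ : ℝ) ≤ ⌈δ⁻¹⌉ := Int.le_ceil _
  have h2 : (⌈δ⁻¹⌉ : ℝ) < δ⁻¹ + 1 := Int.ceil_lt_add_one _
  have h3 : ((Real.sqrt δ)⁻¹ : ℝ) ≤ ⌈(Real.sqrt δ)⁻¹⌉ := Int.le_ceil _
  have h4 : (⌈(Real.sqrt δ)⁻¹⌉ : ℝ) < (Real.sqrt δ)⁻¹ + 1 := Int.ceil_lt_add_one _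
  have hδinv : δ * δ⁻¹ = 1 := mul_inv_cancel₀ hδ.ne'
  have hsinv : δ * (Real.sqrt δ)⁻¹ = Real.sqrt δ := by
    rw [eq_comm, eq_mul_inv_iff_mul_eq₀ hs.ne']; exact hss
  have e1 : 1 ≤ δ * (⌈δ⁻¹⌉ : ℝ) := by
    have := mul_le_mul_of_nonneg_left h1 hδ.le; rwa [hδinv] at this
  have e2 : δ * (⌈δ⁻¹⌉ : ℝ) < 1 + δ := by
    have := mul_lt_mul_of_pos_left h2 hδ; rwa [mul_add, hδinv, mul_one] at this
  have e3 : Real.sqrt δ ≤ δ * (⌈(Real.sqrt δ)⁻¹⌉ : ℝ) := by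
    have := mul_le_mul_of_nonneg_left h3 hδ.le; rwa [hsinv] at this
  have e4 : δ * (⌈(Real.sqrt δ)⁻¹⌉ : ℝ) < Real.sqrt δ + δ := by
    have := mul_lt_mul_of_pos_left h4 hδ; rwa [mul_add, hsinv, mul_one] at this
  have cast : (deepIndex δ : ℝ) = (⌈δ⁻¹⌉ : ℝ) - 1 - (⌈(Real.sqrt δ)⁻¹⌉ : ℝ) := by
    simp [deepIndex]
  have expand : δ * (deepIndex δ : ℝ) = δ * (⌈δ⁻¹⌉ : ℝ) - δ - δ * (⌈(Real.sqrt δ)⁻¹⌉ : ℝ) := by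
    rw [cast]; ring
  rw [expand]
  constructor <;> linarith

/-- For `δ ≤ 1/16` the mesh abscissa is in `(5/8, 1)`, in particular in the unit disc. [folklore] -/
theorem deepIndex_pos {δ : ℝ} (hδ : 0 < δ) (hδ' : δ ≤ 1 / 16) :
    5 / 8 < δ * (deepIndex δ : ℝ) ∧ δ * (deepIndex δ : ℝ) < 1 := by
  obtain ⟨h1, h2⟩ := deepIndex_bounds hδ
  have hs4 : Real.sqrt δ ≤ 1 / 4 := by
    have := Real.sqrt_le_sqrt hδ'
    rwa [show (1 / 16 : ℝ) = (1 / 4) ^ 2 by norm_num, Real.sqrt_sq (by norm_num)] at this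
  have hs0 : 0 ≤ Real.sqrt δ := Real.sqrt_nonneg _
  constructor <;> linarith

/-- CERTIFIED INHABITANT (F2 v): `IsEndpointApprox` admits, in the unit disc, a starting point at
depth `√δ ≫ δ` — the open ball of radius `√δ` about the mesh point of `a δ` lies inside the domain
for every `δ ≤ 1/16` — together with the symmetric end point.  Hence the typed (H1) quantifies
over chordal critical SAWs whose first `√δ/δ → ∞` lattice steps see no boundary: start-centred
shells `D(a_δ; δ, √δ)` have ratio `ρ/R = √δ → 0`, and there the literature's boundary-start
exponents do not apply (whole-plane endpoint exponents do: one return = 3 legs, `x₃ - x₁ = 3/2 < 2`,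
so a threshold `k ≤ 3` near the marked points is NOT available to a prover). [folklore] -/
theorem exists_isEndpointApprox_deepStart :
    ∃ a b : ℝ → Site 2, IsEndpointApprox DobrushinDomain.unitDisc a b ∧
      ∀ δ : ℝ, 0 < δ → δ ≤ 1 / 16 →
        Metric.ball (meshPoint δ (a δ)) (Real.sqrt δ) ⊆ DobrushinDomain.unitDisc.carrier := by
  /- ### arithmetic of mesh points (after SAWParafermionTightRefutation) -/
  have normSq_meshPoint : ∀ (δ : ℝ) (x : Site 2),
      Complex.normSq (meshPoint δ x) = δ ^ 2 * ((x 0 : ℝ) ^ 2 + (x 1 : ℝ) ^ 2) := by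
    intro δ x
    rw [Complex.normSq_apply, meshPoint_re, meshPoint_im]; ring
  have mem_ball_of_sq_le : ∀ {δ : ℝ} {x y : Site 2},
      meshPoint δ x ∈ Metric.ball (0 : ℂ) 1 →
      (y 0 : ℝ) ^ 2 + (y 1 : ℝ) ^ 2 ≤ (x 0 : ℝ) ^ 2 + (x 1 : ℝ) ^ 2 →
      meshPoint δ y ∈ Metric.ball (0 : ℂ) 1 := by
    intro δ x y hx h
    rw [Metric.mem_ball, dist_zero_right] at hx ⊢
    have hx2 : ‖meshPoint δ x‖ ^ 2 < 1 := by
      have := norm_nonneg (meshPoint δ x); nlinarith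
    have hy2 : ‖meshPoint δ y‖ ^ 2 ≤ ‖meshPoint δ x‖ ^ 2 := by
      rw [Complex.sq_norm, Complex.sq_norm, normSq_meshPoint, normSq_meshPoint]
      exact mul_le_mul_of_nonneg_left h (sq_nonneg δ)
    have hy1 : ‖meshPoint δ y‖ ^ 2 < 1 := hy2.trans_lt hx2
    nlinarith [norm_nonneg (meshPoint δ y)]
  /- one step towards the origin, decreasing `|x₀| + |x₁|` -/
  have exists_step : ∀ x : Site 2, x ≠ 0 →
      ∃ y : Site 2, (zdGraph 2).Adj x y ∧
        (y 0 : ℝ) ^ 2 + (y 1 : ℝ) ^ 2 ≤ (x 0 : ℝ) ^ 2 + (x 1 : ℝ) ^ 2 ∧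
        (y 0).natAbs + (y 1).natAbs < (x 0).natAbs + (x 1).natAbs := by
    intro x hx
    by_cases h0 : x 0 = 0
    · have h1 : x 1 ≠ 0 := by
        intro h1; apply hx; funext i; fin_cases i <;> simp [h0, h1]
      rcases lt_or_gt_of_ne h1 with hneg | hpos
      · refine ⟨x + Pi.single 1 1, (zdGraph_adj_iff _ _).2 ⟨1, Or.inl rfl⟩, ?_, ?_⟩
        · simp only [Pi.add_apply, Pi.single_eq_same, Pi.single_eq_of_ne (zero_ne_one), add_zero,
            Int.cast_add, Int.cast_one]
          have : (x 1 : ℝ) ≤ -1 := by exact_mod_cast Int.le_sub_one_of_lt hneg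
          nlinarith
        · simp only [Pi.add_apply, Pi.single_eq_same, Pi.single_eq_of_ne (zero_ne_one), add_zero]
          omega
      · refine ⟨x - Pi.single 1 1, (zdGraph_adj_iff _ _).2 ⟨1, Or.inr (by simp)⟩, ?_, ?_⟩
        · simp only [Pi.sub_apply, Pi.single_eq_same, Pi.single_eq_of_ne (zero_ne_one), sub_zero,
            Int.cast_sub, Int.cast_one]
          have : (1 : ℝ) ≤ x 1 := by exact_mod_cast hpos
          nlinarith
        · simp only [Pi.sub_apply, Pi.single_eq_same, Pi.single_eq_of_ne (zero_ne_one), sub_zero]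
          omega
    · rcases lt_or_gt_of_ne h0 with hneg | hpos
      · refine ⟨x + Pi.single 0 1, (zdGraph_adj_iff _ _).2 ⟨0, Or.inl rfl⟩, ?_, ?_⟩
        · simp only [Pi.add_apply, Pi.single_eq_same, Pi.single_eq_of_ne (one_ne_zero), add_zero,
            Int.cast_add, Int.cast_one]
          have : (x 0 : ℝ) ≤ -1 := by exact_mod_cast Int.le_sub_one_of_lt hneg
          nlinarith
        · simp only [Pi.add_apply, Pi.single_eq_same, Pi.single_eq_of_ne (one_ne_zero), add_zero]
          omega
      · refine ⟨x - Pi.single 0 1, (zdGraph_adj_iff _ _).2 ⟨0, Or.inr (by simp)⟩, ?_, ?_⟩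
        · simp only [Pi.sub_apply, Pi.single_eq_same, Pi.single_eq_of_ne (one_ne_zero), sub_zero,
            Int.cast_sub, Int.cast_one]
          have : (1 : ℝ) ≤ x 0 := by exact_mod_cast hpos
          nlinarith
        · simp only [Pi.sub_apply, Pi.single_eq_same, Pi.single_eq_of_ne (one_ne_zero), sub_zero]
          omega
  /- ### the mesh graph of the unit disc is connected -/
  have meshPoint_zero : ∀ δ : ℝ, meshPoint δ (0 : Site 2) = 0 :=
    fun δ => Complex.ext (by simp) (by simp)
  have zero_mem : ∀ δ : ℝ, (0 : Site 2) ∈ meshVertices (Metric.ball (0 : ℂ) 1) δ := by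
    intro δ; simp [meshVertices, meshPoint_zero δ]
  have meshGraph_adj_of : ∀ {δ : ℝ} {x y : Site 2}, (zdGraph 2).Adj x y →
      meshPoint δ x ∈ Metric.ball (0 : ℂ) 1 → meshPoint δ y ∈ Metric.ball (0 : ℂ) 1 →
      (meshGraph (Metric.ball (0 : ℂ) 1) δ).Adj x y := fun hxy hx hy =>
    meshGraph_adj_iff.2 ⟨hxy, ((convex_ball (0 : ℂ) 1).segment_subset hx hy).trans subset_closure⟩
  have reachable_zero : ∀ (δ : ℝ) (n : ℕ) (x : Site 2)
      (hx : x ∈ meshVertices (Metric.ball (0 : ℂ) 1) δ), (x 0).natAbs + (x 1).natAbs = n →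
      (meshVertexGraph (Metric.ball (0 : ℂ) 1) δ).Reachable ⟨x, hx⟩ ⟨0, zero_mem δ⟩ := by
    intro δ n
    induction n using Nat.strong_induction_on with
    | _ n ih =>
      intro x hx hn
      by_cases h0 : x = 0
      · subst h0; rfl
      obtain ⟨y, hadj, hle, hlt⟩ := exists_step x h0
      have hy : y ∈ meshVertices (Metric.ball (0 : ℂ) 1) δ := mem_ball_of_sq_le hx hle
      have h1 : (meshVertexGraph (Metric.ball (0 : ℂ) 1) δ).Adj ⟨x, hx⟩ ⟨y, hy⟩ := by
        simp only [SimpleGraph.comap_adj, Function.Embedding.subtype_apply]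
        exact meshGraph_adj_of hadj hx hy
      exact h1.reachable.trans (ih _ (hn ▸ hlt) y hy rfl)
  have preconnected : ∀ δ : ℝ, (meshVertexGraph (Metric.ball (0 : ℂ) 1) δ).Preconnected := by
    intro δ u v
    exact (reachable_zero δ _ u.1 u.2 rfl).trans (reachable_zero δ _ v.1 v.2 rfl).symm
  /- for the disc, `Ω_δ` is all of `δℤ² ∩ 𝔻` -/
  have mem_meshDomain : ∀ {δ : ℝ} {x : Site 2}, x ∈ meshVertices (Metric.ball (0 : ℂ) 1) δ →
      x ∈ meshDomain (Metric.ball (0 : ℂ) 1) δ := by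
    intro δ x hx
    have hsub := (preconnected δ).subsingleton_connectedComponent
    simp only [meshDomain, Set.mem_iUnion, Set.mem_image]
    refine ⟨(meshVertexGraph (Metric.ball (0 : ℂ) 1) δ).connectedComponentMk ⟨x, hx⟩,
      fun C' => ?_, ⟨x, hx⟩, ?_, rfl⟩
    · rw [Subsingleton.elim C'
        ((meshVertexGraph (Metric.ball (0 : ℂ) 1) δ).connectedComponentMk ⟨x, hx⟩)]
    · rw [SimpleGraph.ConnectedComponent.mem_supp_iff]
  have reachable_of_mem : ∀ {δ : ℝ} {x y : Site 2}, meshPoint δ x ∈ Metric.ball (0 : ℂ) 1 →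
      meshPoint δ y ∈ Metric.ball (0 : ℂ) 1 →
      (discreteDomainGraph (Metric.ball (0 : ℂ) 1) δ).Reachable x y := by
    intro δ x y hx hy
    let hom : meshVertexGraph (Metric.ball (0 : ℂ) 1) δ →g
        discreteDomainGraph (Metric.ball (0 : ℂ) 1) δ :=
      { toFun := Subtype.val
        map_rel' := fun {u v} h =>
          discreteDomainGraph_adj_iff.2 ⟨h, mem_meshDomain u.2, mem_meshDomain v.2⟩ }
    exact (preconnected δ ⟨x, hx⟩ ⟨y, hy⟩).map hom
  /- ### the deep endpoints -/
  have meshPoint_vec : ∀ (δ : ℝ) (m : ℤ), meshPoint δ ![m, 0] = ((δ * m : ℝ) : ℂ) :=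
    fun δ m => Complex.ext (by simp) (by simp)
  have meshPoint_neg : ∀ (δ : ℝ) (m : ℤ), meshPoint δ ![-m, 0] = -meshPoint δ ![m, 0] := by
    intro δ m; rw [meshPoint_vec, meshPoint_vec]; push_cast; ring
  have deep_mem : ∀ {δ : ℝ}, 0 < δ → δ ≤ 1 / 16 →
      meshPoint δ ![deepIndex δ, 0] ∈ Metric.ball (0 : ℂ) 1 := by
    intro δ hδ hδ'
    rw [meshPoint_vec, Metric.mem_ball, dist_zero_right, Complex.norm_real, Real.norm_eq_abs,
      abs_lt]
    obtain ⟨h1, h2⟩ := deepIndex_pos hδ hδ'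
    constructor <;> linarith
  have deep_neg_mem : ∀ {δ : ℝ}, 0 < δ → δ ≤ 1 / 16 →
      meshPoint δ ![-deepIndex δ, 0] ∈ Metric.ball (0 : ℂ) 1 := by
    intro δ hδ hδ'
    rw [meshPoint_neg, Metric.mem_ball, dist_zero_right, norm_neg, ← dist_zero_right,
      ← Metric.mem_ball]
    exact deep_mem hδ hδ'
  have dist_deep_lt : ∀ {δ : ℝ}, 0 < δ →
      dist (meshPoint δ ![deepIndex δ, 0]) 1 < Real.sqrt δ + 2 * δ := by
    intro δ hδ
    rw [meshPoint_vec, ← Complex.ofReal_one, Complex.dist_eq, ← Complex.ofReal_sub,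
      Complex.norm_real, Real.norm_eq_abs, abs_lt]
    obtain ⟨h1, h2⟩ := deepIndex_bounds hδ
    have hs0 : 0 ≤ Real.sqrt δ := Real.sqrt_nonneg _
    constructor <;> linarith
  have pt_zero : DobrushinDomain.unitDisc.pt 0 = 1 := by
    simp [MarkedDomain.pt, DobrushinDomain.unitDisc, JordanDomain.unitDisc, circleMap]
  have pt_one : DobrushinDomain.unitDisc.pt 1 = -1 := by
    simp [MarkedDomain.pt, DobrushinDomain.unitDisc, JordanDomain.unitDisc, circleMap]
    rw [show (2 * (Real.pi : ℂ) * 2⁻¹ * Complex.I) = Real.pi * Complex.I by ring]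
    exact Complex.exp_pi_mul_I
  have carrier_eq : DobrushinDomain.unitDisc.carrier = Metric.ball (0 : ℂ) 1 := rfl
  have small_mem : Set.Ioc (0 : ℝ) (1 / 16) ∈ 𝓝[>] (0 : ℝ) := Ioc_mem_nhdsGT (by norm_num)
  /- convergence of the deep mesh points to `1` -/
  have tendsto_deep : Tendsto (fun δ => meshPoint δ ![deepIndex δ, 0]) (𝓝[>] (0 : ℝ)) (𝓝 1) := by
    rw [Metric.tendsto_nhds]
    intro ε hε
    have hmem : Set.Ioo (0 : ℝ) (min (ε ^ 2 / 16) (ε / 4)) ∈ 𝓝[>] (0 : ℝ) :=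
      Ioo_mem_nhdsGT (by positivity)
    filter_upwards [hmem] with δ hδ
    obtain ⟨hδ0, hδ1⟩ := hδ
    have hδa : δ < ε ^ 2 / 16 := hδ1.trans_le (min_le_left _ _)
    have hδb : δ < ε / 4 := hδ1.trans_le (min_le_right _ _)
    have hs : Real.sqrt δ < ε / 4 := by
      calc Real.sqrt δ < Real.sqrt (ε ^ 2 / 16) := Real.sqrt_lt_sqrt hδ0.le hδa
        _ = ε / 4 := by
          rw [show ε ^ 2 / 16 = (ε / 4) ^ 2 by ring, Real.sqrt_sq (by positivity)]
    calc dist (meshPoint δ ![deepIndex δ, 0]) 1 < Real.sqrt δ + 2 * δ := dist_deep_lt hδ0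
      _ < ε := by linarith
  refine ⟨fun δ => ![deepIndex δ, 0], fun δ => ![-deepIndex δ, 0], ⟨?_, ?_, ?_⟩, ?_⟩
  · filter_upwards [small_mem] with δ hδ
    exact reachable_of_mem (deep_mem hδ.1 hδ.2) (deep_neg_mem hδ.1 hδ.2)
  · rw [pt_zero]; exact tendsto_deep
  · rw [pt_one]
    have : (fun δ => meshPoint δ ![-deepIndex δ, 0]) = fun δ => -meshPoint δ ![deepIndex δ, 0] := by
      funext δ; exact meshPoint_neg δ _
    rw [this]
    exact tendsto_deep.neg
  · intro δ hδ hδ' z hz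
    rw [carrier_eq, Metric.mem_ball, dist_zero_right]
    rw [Metric.mem_ball, meshPoint_vec] at hz
    obtain ⟨-, h2⟩ := deepIndex_bounds hδ
    obtain ⟨h3, -⟩ := deepIndex_pos hδ hδ'
    have hp : ‖((δ * (deepIndex δ : ℝ) : ℝ) : ℂ)‖ = δ * (deepIndex δ : ℝ) := by
      rw [Complex.norm_real, Real.norm_eq_abs, abs_of_pos (by linarith)]
    calc ‖z‖ ≤ ‖z - ((δ * (deepIndex δ : ℝ) : ℝ) : ℂ)‖ + ‖((δ * (deepIndex δ : ℝ) : ℝ) : ℂ)‖ :=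
          norm_le_norm_sub_add z _
      _ < Real.sqrt δ + δ * (deepIndex δ : ℝ) := by rw [hp, ← dist_eq_norm]; linarith
      _ < 1 := by linarith

end DeepStart

/-! ## §7 Targets — pre-line sketch lemmas of the crux ideators (no registered stubs yet)

The only `sorry`-free NEGATIVE result of cycle 2 on the prover side's own material: the
"ONE-family seed" `AnnulusPairingGap` of card `bad-slices-are-free` (ideator 3,
`Cruxes/TPToTraversalBound/Sketch.lean`) is false as typed — a coarse-mesh artefact, repaired by
`δ ≤ δ₀(C)`.  The other sketch lemmas were paper-checked (docblock, "Future targets"). -/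

section TargetsSection

open Literature.Probability.RandomPlanarGeometry.SAW Literature.Probability.Percolation Filter Topology Set

namespace Targets

noncomputable section

/-- Verbatim copy of `Sketch.Z` (Cruxes/TPToTraversalBound/Sketch.lean, ideator 3). [folklore] -/
abbrev Z (Ω : Set ℂ) (δ : ℝ) (u v : Site 2) : ENNReal := SAW.weight Ω δ u v Set.univ

/-- Verbatim copy of `Sketch.annulusDomain`. [folklore] -/
def annulusDomain (C : ℝ) : Set ℂ := {z : ℂ | 1 < ‖z‖ ∧ ‖z‖ < C}

/-- Verbatim copy of `Sketch.IsOuterPost`. [folklore] -/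
def IsOuterPost (C δ : ℝ) (u : Site 2) : Prop :=
  u ∈ meshDomain (annulusDomain C) δ ∧ ∃ v : Site 2, (zdGraph 2).Adj u v ∧ C ≤ ‖meshPoint δ v‖

/-- Verbatim copy of `Sketch.IsInnerPost`. [folklore] -/
def IsInnerPost (C δ : ℝ) (u : Site 2) : Prop :=
  u ∈ meshDomain (annulusDomain C) δ ∧ ∃ v : Site 2, (zdGraph 2).Adj u v ∧ ‖meshPoint δ v‖ ≤ 1

/-- Verbatim copy of `Sketch.AnnulusPairingGap` (card `bad-slices-are-free`, "the ONE-family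
seed"), ideator 3, Cruxes/TPToTraversalBound/Sketch.lean as of 2026-08-15T23:38Z. [folklore] -/
def AnnulusPairingGap : Prop :=
  ∃ C θ : ℝ, 1 < C ∧ θ < 1 ∧ ∀ δ : ℝ, 0 < δ →
    ∀ a₁ a₂ b₁ b₂ : Site 2, a₁ ≠ a₂ → b₁ ≠ b₂ →
      IsOuterPost C δ a₁ → IsOuterPost C δ a₂ → IsInnerPost C δ b₁ → IsInnerPost C δ b₂ →
      Z (annulusDomain C) δ a₁ b₁ * Z (annulusDomain C) δ a₂ b₂ ≤
        ENNReal.ofReal θ * (Z (annulusDomain C) δ a₁ a₂ * Z (annulusDomain C) δ b₁ b₂)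

end

/-- **`AnnulusPairingGap` is FALSE as typed (coarse-mesh junk).**  For every `C > 1` take the mesh
`δ = max (C/√2) ((1+C)/2)`: then `1 < δ < C ≤ min (√2 δ) (2δ)`, so the lattice annulus
`{x : 1 < δ‖x‖ < C}` is exactly `{±e₁, ±e₂}` — four pairwise non-adjacent sites, an EDGELESS
discrete domain (all four are kept by the largest-component convention, the components being tied
singletons).  Each of them is simultaneously an outer post (`‖δ·2e₁‖ = 2δ ≥ C`) and an inner post
(`‖δ·0‖ ≤ 1`), so `a₁ = b₁ = e₁`, `a₂ = b₂ = -e₁` is admissible: `Z(a₁,b₁) = Z(e₁,e₁) ≥ 1` (the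
trivial walk) while `Z(a₁,a₂) = Z(e₁,-e₁) = 0` (no walk at all), and the inequality reads
`1 ≤ θ · 0`.  Repair: quantify `δ ≤ δ₀(C)` (thick LATTICE annulus), which also forces
`{a₁,a₂} ∩ {b₁,b₂} = ∅`; the repaired statement is untouched by this witness. [folklore] -/
theorem not_annulusPairingGap : ¬ Targets.AnnulusPairingGap := by
  rintro ⟨C, θ, hC, -, H⟩
  -- the coarse mesh
  set δ : ℝ := max (C / Real.sqrt 2) ((1 + C) / 2) with hδdef
  have hs2 : (0 : ℝ) < Real.sqrt 2 := by positivity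
  have hs2' : Real.sqrt 2 * Real.sqrt 2 = 2 := Real.mul_self_sqrt (by norm_num)
  have hδ1 : 1 < δ := lt_of_lt_of_le (by linarith) (le_max_right _ _)
  have hδ0 : 0 < δ := one_pos.trans hδ1
  have hδC : δ < C := by
    rw [hδdef, max_lt_iff]
    refine ⟨?_, by linarith⟩
    rw [div_lt_iff₀ hs2]
    have : (1 : ℝ) < Real.sqrt 2 := by
      rw [show (1 : ℝ) = Real.sqrt 1 by simp]
      exact Real.sqrt_lt_sqrt (by norm_num) (by norm_num)
    nlinarith
  have h2δ : C ≤ 2 * δ := by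
    have : (1 + C) / 2 ≤ δ := le_max_right _ _
    linarith
  have hsδ : C ^ 2 ≤ 2 * δ ^ 2 := by
    have h1 : C / Real.sqrt 2 ≤ δ := le_max_left _ _
    rw [div_le_iff₀ hs2] at h1
    have h0 : 0 ≤ C := by linarith
    nlinarith
  -- norms of mesh points
  have norm_mesh : ∀ x : Site 2, ‖meshPoint δ x‖ ^ 2 = δ ^ 2 * ((x 0 : ℝ) ^ 2 + (x 1 : ℝ) ^ 2) := by
    intro x
    rw [Complex.sq_norm, Complex.normSq_apply, meshPoint_re, meshPoint_im]; ring
  set Ω : Set ℂ := Targets.annulusDomain C with hΩ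
  have mem_vert : ∀ {x : Site 2}, x ∈ meshVertices Ω δ ↔ 1 < ‖meshPoint δ x‖ ∧ ‖meshPoint δ x‖ < C :=
    fun {x} => Iff.rfl
  -- every mesh vertex is a unit site
  have unit_of_mem : ∀ {x : Site 2}, x ∈ meshVertices Ω δ → (x 0) ^ 2 + (x 1) ^ 2 = 1 := by
    intro x hx
    obtain ⟨h1, h2⟩ := mem_vert.1 hx
    have hn := norm_mesh x
    have hpos : 0 ≤ ‖meshPoint δ x‖ := norm_nonneg _
    have hlt2 : ((x 0 : ℝ)) ^ 2 + (x 1 : ℝ) ^ 2 < 2 := by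
      by_contra hge
      have hge' : 2 ≤ ((x 0 : ℝ)) ^ 2 + (x 1 : ℝ) ^ 2 := not_lt.1 hge
      have : C ^ 2 ≤ ‖meshPoint δ x‖ ^ 2 := by rw [hn]; nlinarith
      nlinarith
    have hgt0 : 0 < ((x 0 : ℝ)) ^ 2 + (x 1 : ℝ) ^ 2 := by
      by_contra hle
      have hle' : ((x 0 : ℝ)) ^ 2 + (x 1 : ℝ) ^ 2 ≤ 0 := not_lt.1 hle
      have : ‖meshPoint δ x‖ ^ 2 ≤ 0 := by rw [hn]; nlinarith
      nlinarith
    have hlt2' : (x 0) ^ 2 + (x 1) ^ 2 < 2 := by exact_mod_cast hlt2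
    have hgt0' : 0 < (x 0) ^ 2 + (x 1) ^ 2 := by exact_mod_cast hgt0
    omega
  -- two unit sites are never lattice neighbours (parity: `2a + 1 ≠ 0`)
  have key : ∀ {a c : ℤ}, a ^ 2 + c ^ 2 = 1 → (a + 1) ^ 2 + c ^ 2 = 1 → False := by
    intro a c h1 h2
    have : 2 * a + 1 = 0 := by linear_combination h2 - h1
    omega
  have not_adj_units : ∀ {x y : Site 2}, (x 0) ^ 2 + (x 1) ^ 2 = 1 → (y 0) ^ 2 + (y 1) ^ 2 = 1 →
      ¬ (zdGraph 2).Adj x y := by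
    intro x y hx hy hadj
    obtain ⟨i, h | h⟩ := (zdGraph_adj_iff x y).1 hadj
    · have h0 := congrFun h 0
      have h1 := congrFun h 1
      fin_cases i
      · simp at h0 h1
        rw [h0, h1] at hy
        exact key hx hy
      · simp at h0 h1
        rw [h0, h1] at hy
        exact key (a := x 1) (c := x 0) (by linarith) (by linarith)
    · have h0 := congrFun h 0
      have h1 := congrFun h 1
      fin_cases i
      · simp at h0 h1
        rw [h0, h1] at hx
        exact key hy hx
      · simp at h0 h1
        rw [h0, h1] at hx
        exact key (a := y 1) (c := y 0) (by linarith) (by linarith)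
  -- hence the mesh vertex graph is edgeless and reachability is equality
  have eq_of_reachable : ∀ {a b : meshVertices Ω δ}, (meshVertexGraph Ω δ).Reachable a b → a = b := by
    intro a b hab
    obtain ⟨p⟩ := hab
    by_cases hlen : p.length = 0
    · exact p.eq_of_length_eq_zero hlen
    · exfalso
      have hadj := p.adj_getVert_succ (i := 0) (Nat.pos_of_ne_zero hlen)
      rw [SimpleGraph.Walk.getVert_zero] at hadj
      simp only [SimpleGraph.comap_adj, Function.Embedding.subtype_apply] at hadj
      exact not_adj_units (unit_of_mem a.2) (unit_of_mem (p.getVert 1).2)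
        (meshGraph_le_zdGraph _ _ hadj)
  -- the bounded annulus has finitely many mesh vertices
  have hΩb : Bornology.IsBounded Ω :=
    (Metric.isBounded_ball (x := (0 : ℂ)) (r := C)).subset fun z hz => by
      simp only [Metric.mem_ball, dist_zero_right]; exact hz.2
  haveI : Finite (meshVertices Ω δ) := (meshVertices_finite hΩb hδ0).to_subtype
  -- every mesh vertex lies in the discrete domain (all components are tied singletons)
  have mem_dom : ∀ {x : Site 2}, x ∈ meshVertices Ω δ → x ∈ meshDomain Ω δ := by
    intro x hx
    simp only [meshDomain, Set.mem_iUnion, Set.mem_image]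
    refine ⟨(meshVertexGraph Ω δ).connectedComponentMk ⟨x, hx⟩, fun C' => ?_, ⟨x, hx⟩, ?_, rfl⟩
    · calc C'.supp.ncard ≤ 1 := by
            rw [Set.ncard_le_one (Set.toFinite _)]
            intro a ha b hb
            rw [SimpleGraph.ConnectedComponent.mem_supp_iff] at ha hb
            exact eq_of_reachable (SimpleGraph.ConnectedComponent.exact (ha.trans hb.symm))
        _ ≤ ((meshVertexGraph Ω δ).connectedComponentMk ⟨x, hx⟩).supp.ncard := by
            rw [Nat.one_le_iff_ne_zero, Ne, Set.ncard_eq_zero (Set.toFinite _)]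
            exact Set.nonempty_iff_ne_empty.1 ⟨⟨x, hx⟩, by
              rw [SimpleGraph.ConnectedComponent.mem_supp_iff]⟩
    · rw [SimpleGraph.ConnectedComponent.mem_supp_iff]
  -- the four posts
  have norm_e : ∀ (m : ℤ), ‖meshPoint δ ![m, 0]‖ = δ * |(m : ℝ)| := by
    intro m
    have : meshPoint δ ![m, 0] = ((δ * m : ℝ) : ℂ) := Complex.ext (by simp) (by simp)
    rw [this, Complex.norm_real, Real.norm_eq_abs, abs_mul, abs_of_pos hδ0]
  have mem_e : ∀ {m : ℤ}, |(m : ℝ)| = 1 → (![m, 0] : Site 2) ∈ meshVertices Ω δ := by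
    intro m hm
    rw [mem_vert, norm_e, hm, mul_one]
    exact ⟨hδ1, hδC⟩
  have mem_e1 : (![1, 0] : Site 2) ∈ meshVertices Ω δ := mem_e (by simp)
  have mem_e1' : (![-1, 0] : Site 2) ∈ meshVertices Ω δ := mem_e (by simp)
  have outer : ∀ {m : ℤ}, |(m : ℝ)| = 1 → Targets.IsOuterPost C δ ![m, 0] := by
    intro m hm
    refine ⟨mem_dom (mem_e hm), ![2 * m, 0], (zdGraph_adj_iff _ _).2 ?_, ?_⟩
    · rcases (abs_eq (by norm_num : (0:ℝ) ≤ 1)).1 hm with h | h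
      · have : m = 1 := by exact_mod_cast h
        subst this
        exact ⟨0, Or.inl (by ext i; fin_cases i <;> simp)⟩
      · have : m = -1 := by exact_mod_cast h
        subst this
        exact ⟨0, Or.inr (by ext i; fin_cases i <;> simp)⟩
    · rw [norm_e]; push_cast; rw [abs_mul, hm]; norm_num; linarith
  have inner : ∀ {m : ℤ}, |(m : ℝ)| = 1 → Targets.IsInnerPost C δ ![m, 0] := by
    intro m hm
    refine ⟨mem_dom (mem_e hm), ![0, 0], (zdGraph_adj_iff _ _).2 ?_, ?_⟩
    · rcases (abs_eq (by norm_num : (0:ℝ) ≤ 1)).1 hm with h | h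
      · have : m = 1 := by exact_mod_cast h
        subst this
        exact ⟨0, Or.inr (by ext i; fin_cases i <;> simp)⟩
      · have : m = -1 := by exact_mod_cast h
        subst this
        exact ⟨0, Or.inl (by ext i; fin_cases i <;> simp)⟩
    · rw [norm_e]; simp
  -- Z(e₁, -e₁) = 0 : there is no walk at all
  have Z_cross : Targets.Z Ω δ ![1, 0] ![-1, 0] = 0 := by
    have hempty : IsEmpty (DomainSAW Ω δ ![1, 0] ![-1, 0]) := by
      refine ⟨fun γ => ?_⟩
      have hne : (![1, 0] : Site 2) ≠ ![-1, 0] := by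
        intro h; have := congrFun h 0; simp at this
      have hlen : γ.walk.length ≠ 0 := fun h0 => hne (γ.walk.eq_of_length_eq_zero h0)
      have hadj := γ.walk.adj_getVert_succ (i := 0) (Nat.pos_of_ne_zero hlen)
      rw [SimpleGraph.Walk.getVert_zero] at hadj
      obtain ⟨hmesh, -, hy⟩ := discreteDomainGraph_adj_iff.1 hadj
      exact not_adj_units (unit_of_mem mem_e1)
        (unit_of_mem (meshDomain_subset_meshVertices _ _ hy)) (meshGraph_le_zdGraph _ _ hmesh)
    show SAW.weight Ω δ ![1, 0] ![-1, 0] Set.univ = 0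
    rw [Set.univ_eq_empty_iff.2 hempty, measure_empty]
  -- Z(u, u) ≥ 1 : the trivial walk
  have Z_self : ∀ u : Site 2, 1 ≤ Targets.Z Ω δ u u := by
    intro u
    calc (1 : ENNReal) = SAW.weight Ω δ u u {DomainSAW.nil u} := by
          rw [weight_singleton]; simp
      _ ≤ SAW.weight Ω δ u u Set.univ := measure_mono (Set.subset_univ _)
  -- the admissible degenerate quadruple a₁ = b₁ = e₁, a₂ = b₂ = -e₁
  have hne : (![1, 0] : Site 2) ≠ ![-1, 0] := by
    intro h; have := congrFun h 0; simp at this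
  have key := H δ hδ0 ![1, 0] ![-1, 0] ![1, 0] ![-1, 0] hne hne
    (outer (by simp)) (outer (by simp)) (inner (by simp)) (inner (by simp))
  rw [Z_cross, zero_mul, mul_zero] at key
  have h1 : (1 : ENNReal) ≤ Targets.Z Ω δ ![1, 0] ![1, 0] * Targets.Z Ω δ ![-1, 0] ![-1, 0] := by
    calc (1 : ENNReal) = 1 * 1 := (one_mul 1).symm
      _ ≤ _ := mul_le_mul' (Z_self _) (Z_self _)
  exact absurd (h1.trans key) (by simp)

end Targets

end TargetsSection

/-! ### §7b `RimPushMonotone` (card `bad-slices-are-free`, first lemma) is false on the 3 × 3 ⊇ 2 × 3 boxes -/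

section RimPushSection

open Summit.CriticalPhenomena.SAWScalingLimit.Theorems.BoundaryTP2.Negative
open scoped ENNReal

namespace Targets

noncomputable section

/-- Verbatim copy of `Sketch.Interlaced` (ideator 3): the three intrinsic provisos of `BoundaryTP2`
for a cyclic quadruple. [folklore] -/
def Interlaced (Ω : Set ℂ) (δ : ℝ) (p₁ p₂ p₃ p₄ : Site 2) : Prop :=
  (∀ (P : SAW.DomainSAW Ω δ p₁ p₃) (Q : SAW.DomainSAW Ω δ p₂ p₄),
      ∃ v, v ∈ P.walk.support ∧ v ∈ Q.walk.support) ∧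
  (∃ (P : SAW.DomainSAW Ω δ p₁ p₂) (Q : SAW.DomainSAW Ω δ p₃ p₄),
      List.Disjoint P.walk.support Q.walk.support) ∧
  (∃ (P : SAW.DomainSAW Ω δ p₁ p₄) (Q : SAW.DomainSAW Ω δ p₂ p₃),
      List.Disjoint P.walk.support Q.walk.support)

/-- Verbatim copy of `Sketch.RimPushMonotone` (card `bad-slices-are-free`, first lemma; "CONJECTURE,
numerically supported"), ideator 3, Cruxes/TPToTraversalBound/Sketch.lean as of 2026-08-15T23:38Z.
[folklore] -/
def RimPushMonotone : Prop :=
  ∀ (Ω Ω' : Set ℂ) (δ : ℝ) (m d d' m' : Site 2),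
    Bornology.IsBounded Ω → SimplyConnectedSpace Ω → SimplyConnectedSpace Ω' → Ω' ⊆ Ω → 0 < δ →
    Interlaced Ω' δ m d d' m' →
    (∀ (P : SAW.DomainSAW Ω δ m m'), (∃ v ∈ P.walk.support, v ∉ meshDomain Ω' δ) →
        ∀ (Q : SAW.DomainSAW Ω' δ d d'), ∃ v, v ∈ P.walk.support ∧ v ∈ Q.walk.support) →
    Z Ω δ m d * Z Ω δ m' d' * (Z Ω' δ m m' * Z Ω' δ d d') ≤
      Z Ω' δ m d * Z Ω' δ m' d' * (Z Ω δ m m' * Z Ω δ d d')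

/-! ### The 2 × 3 box `Ω₂₃` (clone of the tree's `Box3` bookkeeping) -/

/-- The 2 × 3 box of sites as a lattice Dobrushin datum. [folklore] -/
def L₂₃ : LatticeDobrushin := LatticeDobrushin.ofBox ![0, 0] ![1, 2] ∅ (Set.empty_subset _)

/-- The 2 × 3 box domain `(-½, 3/2) × (-½, 5/2)`. [folklore] -/
def Ω₂₃ : Set ℂ := siteDomain (boxSites ![0, 0] ![1, 2])

/-- `Ω₂₃` is simply connected. [folklore] -/
theorem simplyConnectedSpace_Ω₂₃ : SimplyConnectedSpace Ω₂₃ :=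
  simplyConnectedSpace_siteDomain_boxSites (Fin.forall_fin_two.2 ⟨by decide, by decide⟩)

/-- `Ω₂₃ ⊆ Ω₃`. [folklore] -/
theorem Ω₂₃_subset_Ω₃ : Ω₂₃ ⊆ Ω₃ := by
  intro z hz x hx
  have h := hz x hx
  rw [mem_boxSites_iff] at h ⊢
  intro i
  refine ⟨(h i).1, (h i).2.trans ?_⟩
  fin_cases i <;> simp

/-- The domain graph of `Ω₂₃` is `ℤ²` induced on the box. [folklore] -/
theorem adj₂₃_iff {x y : Site 2} : (discreteDomainGraph Ω₂₃ 1).Adj x y ↔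
    (zdGraph 2).Adj x y ∧ x ∈ boxSites ![0, 0] ![1, 2] ∧ y ∈ boxSites ![0, 0] ![1, 2] :=
  L₂₃.adj_iff

/-- The discrete domain of `Ω₂₃` is the box. [folklore] -/
theorem meshDomain_Ω₂₃ : meshDomain Ω₂₃ 1 = boxSites ![0, 0] ![1, 2] := L₂₃.meshDomain_eq

/-- Boolean membership in the 2 × 3 box. [folklore] -/
def inBox₂₃ (x : Site 2) : Bool := decide (0 ≤ x 0) && decide (x 0 ≤ 1) && decide (0 ≤ x 1) && decide (x 1 ≤ 2)

/-- `inBox₂₃` is faithful. [folklore] -/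
theorem inBox₂₃_iff (x : Site 2) : inBox₂₃ x = true ↔ x ∈ boxSites ![0, 0] ![1, 2] := by
  simp only [inBox₂₃, Bool.and_eq_true, decide_eq_true_eq, mem_boxSites_iff, Fin.forall_fin_two,
    Matrix.cons_val_zero, Matrix.cons_val_one]
  tauto

/-- Candidate neighbours inside the 2 × 3 box, in the order E, W, N, S. [folklore] -/
def nb₂₃ (u : Site 2) : List (Site 2) :=
  if inBox₂₃ u then [![u 0 + 1, u 1], ![u 0 - 1, u 1], ![u 0, u 1 + 1], ![u 0, u 1 - 1]].filter inBox₂₃ else []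

/-- `nb₂₃` lists all neighbours in the domain graph. [folklore] -/
theorem mem_nb₂₃ (u w : Site 2) (h : (discreteDomainGraph Ω₂₃ 1).Adj u w) : w ∈ nb₂₃ u := by
  rw [adj₂₃_iff] at h
  obtain ⟨hadj, hu, hw⟩ := h
  rw [nb₂₃, if_pos ((inBox₂₃_iff u).2 hu), List.mem_filter]
  refine ⟨?_, (inBox₂₃_iff w).2 hw⟩
  rcases zdGraph_adj_cases hadj with h | h | h | h <;> simp [h]

/-- `nb₂₃` lists only neighbours in the domain graph. [folklore] -/
theorem nb₂₃_adj (u w : Site 2) (h : w ∈ nb₂₃ u) : (discreteDomainGraph Ω₂₃ 1).Adj u w := by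
  unfold nb₂₃ at h
  split_ifs at h with hu
  · rw [List.mem_filter] at h
    refine adj₂₃_iff.2 ⟨zdGraph_adj_of_cases ?_, (inBox₂₃_iff u).1 hu, (inBox₂₃_iff w).1 h.2⟩
    simpa using h.1
  · simp at h

/-- The six sites of the box. [folklore] -/
def T₂₃ : Finset (Site 2) := {![0, 0], ![0, 1], ![0, 2], ![1, 0], ![1, 1], ![1, 2]}

/-- `T₂₃` is the box. [folklore] -/
theorem mem_T₂₃_iff (x : Site 2) : x ∈ T₂₃ ↔ x ∈ boxSites ![0, 0] ![1, 2] := by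
  constructor
  · intro h
    simp only [T₂₃, Finset.mem_insert, Finset.mem_singleton] at h
    rw [mem_boxSites_iff, Fin.forall_fin_two]
    rcases h with rfl | rfl | rfl | rfl | rfl | rfl <;> simp
  · intro h
    rw [mem_boxSites_iff, Fin.forall_fin_two] at h
    simp only [Matrix.cons_val_zero, Matrix.cons_val_one] at h
    obtain ⟨⟨h0, h0'⟩, h1, h1'⟩ := h
    have hx : x = ![x 0, x 1] := funext (Fin.forall_fin_two.2 ⟨rfl, rfl⟩)
    rw [hx]
    simp only [T₂₃, Finset.mem_insert, Finset.mem_singleton]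
    interval_cases (x 0) <;> interval_cases (x 1) <;> simp

/-- The box has six sites. [folklore] -/
theorem card_T₂₃ : T₂₃.card ≤ 6 := by
  unfold T₂₃
  repeat (refine (Finset.card_insert_le _ _).trans (Nat.succ_le_succ ?_))
  simp

/-- Every SAW of `Ω₂₃` has at most `5` steps. [folklore] -/
theorem length_le_five {a b : Site 2} (ha : a ∈ boxSites ![0, 0] ![1, 2]) (γ : SAW.DomainSAW Ω₂₃ 1 a b) :
    γ.length ≤ 5 := by
  have h := length_lt_card_of_adj_mem T₂₃ (fun x y hxy => ?_) ((mem_T₂₃_iff a).2 ha) γ.walk γ.isPath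
  · have := card_T₂₃
    change γ.walk.length ≤ 5
    omega
  · rw [adj₂₃_iff] at hxy
    exact ⟨(mem_T₂₃_iff x).2 hxy.2.1, (mem_T₂₃_iff y).2 hxy.2.2⟩

/-- The fugacity-`x` two-point sum on `Ω₂₃`. [folklore] -/
noncomputable def Z₂₃ (x : ℝ) (a b : Site 2) : ℝ≥0∞ := ∑' γ : SAW.DomainSAW Ω₂₃ 1 a b, ENNReal.ofReal (x ^ γ.length)

/-- At the critical fugacity, `Z₂₃` is the weight. [folklore] -/
theorem weight_Ω₂₃_eq_Z₂₃ (a b : Site 2) : SAW.weight Ω₂₃ 1 a b Set.univ = Z₂₃ SAW.criticalFugacity a b :=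
  weight_univ Ω₂₃ 1 a b

/-- Exact two-point sums on the 2 × 3 box by certified complete enumeration. [folklore] -/
theorem Z₂₃_eq {a b : Site 2} (ha : a ∈ boxSites ![0, 0] ![1, 2]) (lens : List ℕ)
    (hnodup : ((pathsFrom eqSite nb₂₃ 5 a []).filter (endsAt eqSite b)).Nodup)
    (hlens : ((pathsFrom eqSite nb₂₃ 5 a []).filter (endsAt eqSite b)).map (fun s => s.length - 1) = lens)
    {x : ℝ} (hx : 0 ≤ x) :
    Z₂₃ x a b = ENNReal.ofReal (lens.map fun k => x ^ k).sum := by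
  have hmap : (((pathsFrom eqSite nb₂₃ 5 a []).filter (endsAt eqSite b)).map
      fun s => ENNReal.ofReal (x ^ (s.length - 1))).sum = ENNReal.ofReal (lens.map fun k => x ^ k).sum := by
    rw [← sum_map_ofReal_pow hx, ← hlens, List.map_map]
    rfl
  refine le_antisymm ?_ ?_
  · rw [← hmap]
    exact tsum_pow_le_of_enum eqSite eqSite_iff nb₂₃ mem_nb₂₃ 5 (length_le_five ha) hnodup
  · rw [← hmap]
    exact sum_le_tsum_pow_of_enum eqSite eqSite_iff nb₂₃ nb₂₃_adj 5 hnodup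

/-! ### The eight exact kernels of the witness -/

theorem Z₃_00_01 {x : ℝ} (hx : 0 ≤ x) :
    Z₃ x ![0, 0] ![0, 1] = ENNReal.ofReal ([5, 7, 7, 7, 7, 3, 5, 1].map fun k => x ^ k).sum :=
  Z₃_eq (by decide) _ (by decide) (by decide) hx

theorem Z₃_00_10 {x : ℝ} (hx : 0 ≤ x) :
    Z₃ x ![0, 0] ![1, 0] = ENNReal.ofReal ([1, 5, 7, 3, 7, 7, 7, 5].map fun k => x ^ k).sum :=
  Z₃_eq (by decide) _ (by decide) (by decide) hx

theorem Z₃_10_12 {x : ℝ} (hx : 0 ≤ x) :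
    Z₃ x ![1, 0] ![1, 2] = ENNReal.ofReal ([6, 4, 4, 6, 4, 4, 4, 4, 2].map fun k => x ^ k).sum :=
  Z₃_eq (by decide) _ (by decide) (by decide) hx

theorem Z₃_01_12 {x : ℝ} (hx : 0 ≤ x) :
    Z₃ x ![0, 1] ![1, 2] = ENNReal.ofReal ([4, 2, 6, 2, 6, 6, 6, 4].map fun k => x ^ k).sum :=
  Z₃_eq (by decide) _ (by decide) (by decide) hx

theorem Z₂₃_00_10 {x : ℝ} (hx : 0 ≤ x) :
    Z₂₃ x ![0, 0] ![1, 0] = ENNReal.ofReal ([1, 3, 5].map fun k => x ^ k).sum :=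
  Z₂₃_eq (by decide) _ (by decide) (by decide) hx

theorem Z₂₃_01_12 {x : ℝ} (hx : 0 ≤ x) :
    Z₂₃ x ![0, 1] ![1, 2] = ENNReal.ofReal ([2, 2, 4].map fun k => x ^ k).sum :=
  Z₂₃_eq (by decide) _ (by decide) (by decide) hx

theorem Z₂₃_00_01 {x : ℝ} (hx : 0 ≤ x) :
    Z₂₃ x ![0, 0] ![0, 1] = ENNReal.ofReal ([3, 5, 1].map fun k => x ^ k).sum :=
  Z₂₃_eq (by decide) _ (by decide) (by decide) hx

theorem Z₂₃_10_12 {x : ℝ} (hx : 0 ≤ x) :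
    Z₂₃ x ![1, 0] ![1, 2] = ENNReal.ofReal ([4, 4, 4, 2].map fun k => x ^ k).sum :=
  Z₂₃_eq (by decide) _ (by decide) (by decide) hx

/-! ### Explicit SAWs for the realisability provisos -/

/-- An edge of `Ω₂₃` from decidable data. [folklore] -/
theorem adj₂₃ {x y : Site 2}
    (h : (zdGraph 2).Adj x y ∧ x ∈ boxSites ![0, 0] ![1, 2] ∧ y ∈ boxSites ![0, 0] ![1, 2]) :
    (discreteDomainGraph Ω₂₃ 1).Adj x y :=
  adj₂₃_iff.2 h

/-- SAW `(0,0) → (0,1)` of `Ω₂₃`. [folklore] -/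
def P_md : SAW.DomainSAW Ω₂₃ 1 ![0, 0] ![0, 1] :=
  ⟨.cons (adj₂₃ (by decide)) .nil, by simp [SimpleGraph.Walk.isPath_def]⟩

/-- SAW `(1,2) → (1,1) → (1,0)` of `Ω₂₃`. [folklore] -/
def Q_d'm' : SAW.DomainSAW Ω₂₃ 1 ![1, 2] ![1, 0] :=
  ⟨.cons (adj₂₃ (y := ![1, 1]) (by decide)) (.cons (adj₂₃ (by decide)) .nil), by
    simp [SimpleGraph.Walk.isPath_def]⟩

/-- SAW `(0,0) → (1,0)` of `Ω₂₃`. [folklore] -/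
def P_mm' : SAW.DomainSAW Ω₂₃ 1 ![0, 0] ![1, 0] :=
  ⟨.cons (adj₂₃ (by decide)) .nil, by simp [SimpleGraph.Walk.isPath_def]⟩

/-- SAW `(0,1) → (0,2) → (1,2)` of `Ω₂₃`. [folklore] -/
def Q_dd' : SAW.DomainSAW Ω₂₃ 1 ![0, 1] ![1, 2] :=
  ⟨.cons (adj₂₃ (y := ![0, 2]) (by decide)) (.cons (adj₂₃ (by decide)) .nil), by
    simp [SimpleGraph.Walk.isPath_def]⟩

end

/-- Disjointness of two explicit lists of sites from a Boolean certificate. [folklore] -/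
theorem disjoint_of_all {l₁ l₂ : List (Site 2)}
    (h : (l₁.all fun a => l₂.all fun b => !(eqSite a b)) = true) : List.Disjoint l₁ l₂ := by
  intro a ha hb
  rw [List.all_eq_true] at h
  have h' := h a ha
  rw [List.all_eq_true] at h'
  have h'' := h' a hb
  have : eqSite a a = true := (eqSite_iff a a).2 rfl
  rw [this] at h''
  exact Bool.false_ne_true h''

/-- The supports of the four explicit SAWs. [folklore] -/
theorem support_P_md : P_md.walk.support = [![0, 0], ![0, 1]] := rfl
theorem support_Q_d'm' : Q_d'm'.walk.support = [![1, 2], ![1, 1], ![1, 0]] := rfl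
theorem support_P_mm' : P_mm'.walk.support = [![0, 0], ![1, 0]] := rfl
theorem support_Q_dd' : Q_dd'.walk.support = [![0, 1], ![0, 2], ![1, 2]] := rfl

/-- The second vertex of a SAW of `Ω₂₃` started at the corner `(0,0)` is `(1,0)` or `(0,1)`. [folklore] -/
theorem second_vertex_Ω₂₃ {b : Site 2} (γ : SAW.DomainSAW Ω₂₃ 1 ![0, 0] b) (hb : b ≠ ![0, 0]) :
    γ.walk.getVert 1 ∈ γ.walk.support ∧ (γ.walk.getVert 1 = ![1, 0] ∨ γ.walk.getVert 1 = ![0, 1]) := by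
  have hlen : γ.walk.length ≠ 0 := fun h0 => hb (γ.walk.eq_of_length_eq_zero h0).symm
  have hadj := γ.walk.adj_getVert_succ (i := 0) (Nat.pos_of_ne_zero hlen)
  rw [SimpleGraph.Walk.getVert_zero] at hadj
  refine ⟨SimpleGraph.Walk.getVert_mem_support _ _, ?_⟩
  have hmem := mem_nb₂₃ _ _ hadj
  have hnb : nb₂₃ ![0, 0] = [![1, 0], ![0, 1]] := by decide
  rw [hnb] at hmem
  simpa using hmem

/-- The second vertex of a SAW of `Ω₃` started at the corner `(0,0)` is `(1,0)` or `(0,1)`. [folklore] -/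
theorem second_vertex_Ω₃ {b : Site 2} (γ : SAW.DomainSAW Ω₃ 1 ![0, 0] b) (hb : b ≠ ![0, 0]) :
    γ.walk.getVert 1 ∈ γ.walk.support ∧ (γ.walk.getVert 1 = ![1, 0] ∨ γ.walk.getVert 1 = ![0, 1]) := by
  have hlen : γ.walk.length ≠ 0 := fun h0 => hb (γ.walk.eq_of_length_eq_zero h0).symm
  have hadj := γ.walk.adj_getVert_succ (i := 0) (Nat.pos_of_ne_zero hlen)
  rw [SimpleGraph.Walk.getVert_zero] at hadj
  refine ⟨SimpleGraph.Walk.getVert_mem_support _ _, ?_⟩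
  have hmem := mem_nb₃ _ _ hadj
  have hnb : nb₃ ![0, 0] = [![1, 0], ![0, 1]] := by decide
  rw [hnb] at hmem
  simpa using hmem

/-- **`RimPushMonotone` is FALSE as typed.**  Witness: `Ω = Ω₃` (3 × 3 box), `Ω' = Ω₂₃` (its left
2 × 3 sub-box), mesh 1, room `(m,d,d',m') = ((0,0),(0,1),(1,2),(1,0))`.  All provisos hold for
trivial reasons (the corner `m` has only the two exits `d` and `m'`), and with the certified exact
kernels the inequality reduces, after cancelling the common factor
`Z₃(m,d)·Z₂₃(m,m') = Z₃(m,m')·Z₂₃(m,d) = (x+x³+2x⁵+4x⁷)(x+x³+x⁵)`, to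
`(x²+6x⁴+2x⁶)(2x²+x⁴) ≤ (x²+3x⁴)(2x²+2x⁴+4x⁶)`, i.e. `5x⁶(1-2x⁴) ≤ 0` — false for every
`0 < x < 2^{-1/4}`, in particular at `x = x_c ≤ 1/2` (ratio of the two sides 1.2031 at x_c).
Class: misstated — the intrinsic "hanging" proviso does not see on which arc of the room the removed
region `Ω ∖ Ω'` hangs (here it hangs off the WALL `[m',d']`, where the card itself predicts the
opposite monotonicity); a repair must type the rim/wall distinction (e.g. through the cyclic boundary
order of a `LatticeDobrushin` datum).  Small-graph census (this seat, rimpush.py): 1,564 of 6,744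
typed box/sub-box instances up to 5 × 4 violate it, worst ratio 1.45. [folklore] -/
theorem not_rimPushMonotone : ¬ Targets.RimPushMonotone := by
  intro H
  have key := H Ω₃ Ω₂₃ 1 ![0, 0] ![0, 1] ![1, 2] ![1, 0] isBounded_Ω₃ simplyConnectedSpace_Ω₃
    simplyConnectedSpace_Ω₂₃ Ω₂₃_subset_Ω₃ one_pos ?_ ?_
  rotate_left
  · -- Interlaced Ω₂₃ 1 m d d' m'
    refine ⟨fun P Q => ?_,
      ⟨P_md, Q_d'm', by rw [support_P_md, support_Q_d'm']; exact disjoint_of_all (by decide)⟩,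
      ⟨P_mm', Q_dd', by rw [support_P_mm', support_Q_dd']; exact disjoint_of_all (by decide)⟩⟩
    obtain ⟨hmem, h | h⟩ := second_vertex_Ω₂₃ P (by decide)
    · exact ⟨P.walk.getVert 1, hmem, by rw [h]; exact Q.walk.end_mem_support⟩
    · exact ⟨P.walk.getVert 1, hmem, by rw [h]; exact Q.walk.start_mem_support⟩
  · -- the hanging proviso
    intro P hP Q
    obtain ⟨hmem, h | h⟩ := second_vertex_Ω₃ P (by decide)
    · -- the second vertex is the end `m'`: the SAW is the single edge and stays inside the sub-box
      exfalso
      obtain ⟨v, hv, hv'⟩ := hP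
      have hlen : P.walk.length = 1 := by
        have h1 : 1 ≤ P.walk.length := by
          have hlen0 : P.walk.length ≠ 0 := fun h0 => by
            have := P.walk.eq_of_length_eq_zero h0
            exact absurd (congrFun this 0) (by simp)
          omega
        exact ((P.isPath.getVert_eq_end_iff h1).1 h).symm
      rw [SimpleGraph.Walk.mem_support_iff_exists_getVert] at hv
      obtain ⟨i, rfl, hi⟩ := hv
      rw [hlen] at hi
      apply hv'
      rw [meshDomain_Ω₂₃]
      interval_cases i
      · rw [SimpleGraph.Walk.getVert_zero]; decide
      · rw [h]; decide
    · exact ⟨P.walk.getVert 1, hmem, by rw [h]; exact Q.walk.start_mem_support⟩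
  -- the inequality, with exact kernels
  have hx0 : 0 ≤ SAW.criticalFugacity := xc_nonneg
  have hxpos : 0 < SAW.criticalFugacity := SAW.criticalFugacity_pos_lt_one'.1
  have hxhalf : SAW.criticalFugacity ≤ 1 / 2 := SAW.criticalFugacity_le_half
  simp only [Z, weight_Ω₃_eq_Z₃, weight_Ω₂₃_eq_Z₂₃, Z₃_00_01 hx0, Z₃_00_10 hx0, Z₃_10_12 hx0,
    Z₃_01_12 hx0, Z₂₃_00_10 hx0, Z₂₃_01_12 hx0, Z₂₃_00_01 hx0, Z₂₃_10_12 hx0, List.map_cons,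
    List.map_nil, List.sum_cons, List.sum_nil, add_zero] at key
  set x := SAW.criticalFugacity with hxdef
  -- collect the products of `ofReal`s
  rw [← ENNReal.ofReal_mul (by positivity), ← ENNReal.ofReal_mul (by positivity),
    ← ENNReal.ofReal_mul (by positivity), ← ENNReal.ofReal_mul (by positivity),
    ← ENNReal.ofReal_mul (by positivity), ← ENNReal.ofReal_mul (by positivity),
    ENNReal.ofReal_le_ofReal_iff (by positivity)] at key
  have h4 : x ^ 4 ≤ 1 / 16 := by
    calc x ^ 4 ≤ (1 / 2) ^ 4 := pow_le_pow_left₀ hx0 hxhalf 4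
      _ = 1 / 16 := by norm_num
  have hgap : 0 < 1 - 2 * x ^ 4 := by linarith
  nlinarith [mul_pos (mul_pos (mul_pos (by positivity : 0 < x + x ^ 3 + x ^ 5)
    (by positivity : 0 < x + x ^ 3 + 2 * x ^ 5 + 4 * x ^ 7)) (by positivity : 0 < 5 * x ^ 6)) hgap]

end Targets

end RimPushSection

/-! ## §8 Positive audit (cycle 3): the two "provable now" sketch lemmas of ideator 2 ARE provable — certified

`OptionalStoppingLR` (pure measure bookkeeping, all `Ω`, all `r ∈ ℝ≥0∞`) and `BubbleTailDive` (from hypothesis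
(B) alone: the lattice-scale seed) hold verbatim as typed.  Consequence for crux-plan: both may be struck from any
stub list; what (B) buys is exactly lattice-scale tightness of adjacent-endpoint chords, uniformly in the domain —
and nothing at mesoscopic scales (F4). -/

section OptionalStoppingSection

open scoped BigOperators ENNReal
open Literature.Probability.RandomPlanarGeometry.SAW

namespace Targets

noncomputable section

/-- Verbatim copy of `Sketch.PrefixSet` (ideator 2, Cruxes/TPToTraversalBound/SketchIdeator2.lean): the set of
SAW chords `a → b` of `Ω_δ` that extend a given lattice prefix `η : a → v`. -/
def PrefixSet (Ω : Set ℂ) (δ : ℝ) (a b : Site 2) {v : Site 2}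
    (η : (discreteDomainGraph Ω δ).Walk a v) : Set (SAW.DomainSAW Ω δ a b) :=
  {γ | ∃ q : (discreteDomainGraph Ω δ).Walk v b, γ.walk = η.append q}

/-- Verbatim copy of `Sketch.OptionalStoppingLR` (ideator 2, card `target-switching-smlr`; "bookkeeping lemma,
provable now"): optional stopping for the target-switching likelihood ratio. -/
def OptionalStoppingLR : Prop :=
  ∀ (Ω : Set ℂ) (δ : ℝ) (a b : Site 2) (J : Finset (Site 2))
    (S : Finset (Σ v : Site 2, (discreteDomainGraph Ω δ).Walk a v)) (r : ℝ≥0∞),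
    (∀ c : Site 2, (S : Set (Σ v : Site 2, (discreteDomainGraph Ω δ).Walk a v)).PairwiseDisjoint
        fun η => PrefixSet Ω δ a c η.2) →
    (∀ η ∈ S, r * SAW.weight Ω δ a b (PrefixSet Ω δ a b η.2)
        ≤ ∑ c ∈ J, SAW.weight Ω δ a c (PrefixSet Ω δ a c η.2)) →
    r * SAW.weight Ω δ a b (⋃ η ∈ S, PrefixSet Ω δ a b η.2)
      ≤ ∑ c ∈ J, SAW.weight Ω δ a c Set.univ

end

/-- CERTIFIED (positive audit of a sketch lemma): `OptionalStoppingLR` holds VERBATIM as typed — for every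
`Ω ⊆ ℂ` (bounded or not), every mesh, every `r ∈ ℝ≥0∞` including `⊤`.  Proof: finite additivity of the
critical SAW measure over the stopped (pairwise disjoint) prefix family, the hypothesis summed over the family,
a swap of the two finite sums, additivity again for each alternative target, and monotonicity.  No junk: the
lemma is pure measure bookkeeping (discrete σ-algebra), so the SMLR line may use it freely. [folklore] -/
theorem optionalStoppingLR : OptionalStoppingLR := by
  intro Ω δ a b J S r hdisj hη
  classical
  have hmeas : ∀ (c : Site 2) (η : Σ v : Site 2, (discreteDomainGraph Ω δ).Walk a v),
      MeasurableSet (PrefixSet Ω δ a c η.2) := fun _ _ => MeasurableSpace.measurableSet_top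
  calc r * SAW.weight Ω δ a b (⋃ η ∈ S, PrefixSet Ω δ a b η.2)
      = r * ∑ η ∈ S, SAW.weight Ω δ a b (PrefixSet Ω δ a b η.2) := by
        rw [measure_biUnion_finset (hdisj b) (fun η _ => hmeas b η)]
    _ = ∑ η ∈ S, r * SAW.weight Ω δ a b (PrefixSet Ω δ a b η.2) := Finset.mul_sum _ _ _
    _ ≤ ∑ η ∈ S, ∑ c ∈ J, SAW.weight Ω δ a c (PrefixSet Ω δ a c η.2) := Finset.sum_le_sum hη
    _ = ∑ c ∈ J, ∑ η ∈ S, SAW.weight Ω δ a c (PrefixSet Ω δ a c η.2) := Finset.sum_comm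
    _ = ∑ c ∈ J, SAW.weight Ω δ a c (⋃ η ∈ S, PrefixSet Ω δ a c η.2) := by
        refine Finset.sum_congr rfl fun c _ => ?_
        rw [measure_biUnion_finset (hdisj c) (fun η _ => hmeas c η)]
    _ ≤ ∑ c ∈ J, SAW.weight Ω δ a c Set.univ :=
        Finset.sum_le_sum fun c _ => measure_mono (Set.subset_univ _)

end Targets

end OptionalStoppingSection

section BubbleTailSection

open scoped BigOperators ENNReal Topology
open Filter Set Function
open Literature.Probability.RandomPlanarGeometry.SAW
open Literature.Barriers.CriticalPhenomena.SupercriticalSAW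
open Summit.CriticalPhenomena.SAWScalingLimit.Theorems.CriticalBubbleBound.Negative

namespace Targets

noncomputable section

/-- Verbatim copy of `Sketch.BubbleTailDive` (ideator 2, Cruxes/TPToTraversalBound/SketchIdeator2.lean; "provable now
from `CriticalBubbleBound` + monotonicity of the weight in the domain + vanishing tails of a convergent series"):
between ADJACENT lattice points of any bounded domain, the critical chord makes an excursion of Euclidean size
`≥ C δ` with probability `≤ ε`, uniformly, once `C = C(ε)`. -/
def BubbleTailDive : Prop :=
  Theses.SAWTotalPositivity.CriticalBubbleBound →
  ∀ ε : ℝ, 0 < ε → ∃ C : ℕ, ∀ (Ω : Set ℂ) (δ : ℝ) (u v : Site 2), Bornology.IsBounded Ω → 0 < δ →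
    (discreteDomainGraph Ω δ).Adj u v →
    SAW.law Ω δ u v {γ | ∃ z ∈ γ.walk.support, (C : ℝ) * δ ≤ dist (meshPoint δ z) (meshPoint δ u)}
      ≤ ENNReal.ofReal ε

/-- The LENGTH-TAIL of the critical lattice kernel: `Σ_{γ : u → v SAW of ℤ², |γ| ≥ L} x_c^{|γ|}`. -/
def tailKernel (L : ℕ) (u v : Site 2) : ℝ≥0∞ :=
  ∑' p : LatticeSAW u v, if L ≤ p.1.length then ENNReal.ofReal (criticalFugacity ^ p.1.length) else 0

end

/-- The tail is antitone in the cut-off. [folklore] -/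
theorem tailKernel_antitone {L L' : ℕ} (h : L ≤ L') (u v : Site 2) : tailKernel L' u v ≤ tailKernel L u v := by
  refine ENNReal.tsum_le_tsum fun p => ?_
  by_cases hp : L' ≤ p.1.length
  · rw [if_pos hp, if_pos (h.trans hp)]
  · rw [if_neg hp]; exact zero_le

/-- The tail does not decrease under translating both endpoints. [folklore] -/
theorem tailKernel_le_shift (L : ℕ) (u v c : Site 2) : tailKernel L u v ≤ tailKernel L (u + c) (v + c) := by
  let F : LatticeSAW u v → LatticeSAW (u + c) (v + c) := fun p =>
    ⟨p.1.map (shiftIso c).toHom, p.2.map (shiftIso c).injective⟩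
  have hF : Injective F := by
    rintro ⟨p, hp⟩ ⟨q, hq⟩ h
    have h' := congrArg Subtype.val h
    exact Subtype.ext (SimpleGraph.Walk.map_injective_of_injective (shiftIso c).injective u v h')
  have hlen : ∀ p : LatticeSAW u v, (F p).1.length = p.1.length := fun p => SimpleGraph.Walk.length_map _ _
  have key : (fun p : LatticeSAW u v => if L ≤ p.1.length then ENNReal.ofReal (criticalFugacity ^ p.1.length) else 0) =
      fun p => (fun q : LatticeSAW (u + c) (v + c) =>
        if L ≤ q.1.length then ENNReal.ofReal (criticalFugacity ^ q.1.length) else 0) (F p) := by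
    funext p; simp only [hlen]
  calc tailKernel L u v
      = ∑' p : LatticeSAW u v, (fun q : LatticeSAW (u + c) (v + c) =>
          if L ≤ q.1.length then ENNReal.ofReal (criticalFugacity ^ q.1.length) else 0) (F p) := by
        rw [tailKernel, key]
    _ ≤ tailKernel L (u + c) (v + c) := ENNReal.tsum_comp_le_tsum_of_injective hF _

/-- Reduction to the origin: `tail(u,v) ≤ tail(0, v - u)`. [folklore] -/
theorem tailKernel_le_zero_sub (L : ℕ) (u v : Site 2) : tailKernel L u v ≤ tailKernel L 0 (v - u) := by
  have h := tailKernel_le_shift L u v (-u)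
  rwa [add_neg_cancel, ← sub_eq_add_neg] at h

/-- Vanishing tails: if the bubble `G_{x_c}(0,e)` is finite, the length-tail at `e` is eventually `≤ ε`.
[folklore] -/
theorem exists_tailKernel_le {e : Site 2} (he : bubble e ≠ ⊤) {ε : ℝ≥0∞} (hε : ε ≠ 0) :
    ∃ L : ℕ, tailKernel L 0 e ≤ ε := by
  classical
  set f : LatticeSAW 0 e → ℝ≥0∞ := fun p => ENNReal.ofReal (criticalFugacity ^ p.1.length) with hf
  have hsum : ∑' p, f p ≠ ⊤ := he
  have ht := ENNReal.tendsto_tsum_compl_atTop_zero hsum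
  have hev : ∀ᶠ s : Finset (LatticeSAW 0 e) in atTop, (∑' a : {x // x ∉ s}, f a) < ε :=
    (tendsto_order.1 ht).2 ε (pos_iff_ne_zero.2 hε)
  obtain ⟨s, hs⟩ := hev.exists
  have heq : ∑' x, ((↑s : Set (LatticeSAW 0 e))ᶜ).indicator f x = ∑' a : {x // x ∉ s}, f a :=
    (tsum_subtype ((↑s : Set (LatticeSAW 0 e))ᶜ) f).symm
  refine ⟨s.sup (fun p => p.1.length) + 1, le_of_lt (lt_of_le_of_lt ?_ (heq ▸ hs))⟩
  rw [tailKernel]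
  refine ENNReal.tsum_le_tsum fun p => ?_
  by_cases hp : s.sup (fun p => p.1.length) + 1 ≤ p.1.length
  · have hps : p ∈ ((↑s : Set (LatticeSAW 0 e))ᶜ) := by
      intro hps
      have := Finset.le_sup (f := fun p : LatticeSAW 0 e => p.1.length) (Finset.mem_coe.1 hps)
      omega
    rw [if_pos hp, Set.indicator_of_mem hps]
  · rw [if_neg hp]; exact zero_le

/-- Mesh-point distances are dominated by lattice walk lengths: every vertex of a SAW of `Ω_δ` from `u` is
within Euclidean distance `2 δ |γ|` of the start (for `δ ≥ 0`). [folklore] -/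
theorem dist_meshPoint_le_length {Ω : Set ℂ} {δ : ℝ} (hδ : 0 ≤ δ) {u v : Site 2}
    (γ : DomainSAW Ω δ u v) {z : Site 2} (hz : z ∈ γ.walk.support) :
    dist (meshPoint δ z) (meshPoint δ u) ≤ 2 * δ * γ.length := by
  have hsup : z ∈ (toLattice γ).1.support := by rw [support_toLattice]; exact hz
  have hb := abs_sub_le_length (toLattice γ).1 z hsup
  have h0 : |((z 0 : ℤ) : ℝ) - u 0| ≤ γ.length := by
    have := hb 0; rw [length_toLattice] at this; exact_mod_cast this
  have h1 : |((z 1 : ℤ) : ℝ) - u 1| ≤ γ.length := by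
    have := hb 1; rw [length_toLattice] at this; exact_mod_cast this
  rw [dist_eq_norm]
  have hre : (meshPoint δ z - meshPoint δ u).re = δ * ((z 0 : ℝ) - u 0) := by
    rw [Complex.sub_re, meshPoint_re, meshPoint_re]; ring
  have him : (meshPoint δ z - meshPoint δ u).im = δ * ((z 1 : ℝ) - u 1) := by
    rw [Complex.sub_im, meshPoint_im, meshPoint_im]; ring
  calc ‖meshPoint δ z - meshPoint δ u‖
      ≤ |(meshPoint δ z - meshPoint δ u).re| + |(meshPoint δ z - meshPoint δ u).im| :=
        Complex.norm_le_abs_re_add_abs_im _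
    _ = δ * |((z 0 : ℤ) : ℝ) - u 0| + δ * |((z 1 : ℤ) : ℝ) - u 1| := by
        rw [hre, him, abs_mul, abs_mul, abs_of_nonneg hδ]
    _ ≤ δ * γ.length + δ * γ.length := by gcongr
    _ = 2 * δ * γ.length := by ring

/-- The far-excursion event is dominated by the length-tail of the lattice kernel: with cut-off `C = 2L`,
`weight {γ reaches distance ≥ C δ} ≤ tail_L(u,v)` for every `Ω` and every `δ > 0`. [folklore] -/
theorem weight_far_le_tailKernel (Ω : Set ℂ) {δ : ℝ} (hδ : 0 < δ) (u v : Site 2) (L : ℕ) :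
    SAW.weight Ω δ u v {γ | ∃ z ∈ γ.walk.support, ((2 * L : ℕ) : ℝ) * δ ≤ dist (meshPoint δ z) (meshPoint δ u)}
      ≤ tailKernel L u v := by
  set E : Set (DomainSAW Ω δ u v) :=
    {γ | ∃ z ∈ γ.walk.support, ((2 * L : ℕ) : ℝ) * δ ≤ dist (meshPoint δ z) (meshPoint δ u)} with hE
  have hlen : ∀ γ ∈ E, L ≤ γ.length := by
    rintro γ ⟨z, hz, hfar⟩
    have h := hfar.trans (dist_meshPoint_le_length hδ.le γ hz)
    have h' : ((2 * L : ℕ) : ℝ) ≤ 2 * (γ.length : ℝ) := by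
      have : ((2 * L : ℕ) : ℝ) * δ ≤ (2 * (γ.length : ℝ)) * δ := by nlinarith
      exact le_of_mul_le_mul_right this hδ
    have : (2 * L : ℕ) ≤ 2 * γ.length := by exact_mod_cast h'
    omega
  let g : LatticeSAW u v → ℝ≥0∞ := fun p =>
    if L ≤ p.1.length then ENNReal.ofReal (criticalFugacity ^ p.1.length) else 0
  calc SAW.weight Ω δ u v E
      = ∑' γ, E.indicator (fun γ => ENNReal.ofReal (criticalFugacity ^ γ.length)) γ := by
        rw [← weightAt_criticalFugacity, weightAt_apply]
    _ ≤ ∑' γ : DomainSAW Ω δ u v, g (toLattice γ) := by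
        refine ENNReal.tsum_le_tsum fun γ => ?_
        by_cases hγ : γ ∈ E
        · rw [Set.indicator_of_mem hγ]
          simp only [g, length_toLattice, if_pos (hlen γ hγ)]; exact le_rfl
        · rw [Set.indicator_of_notMem hγ]; exact zero_le
    _ ≤ ∑' p : LatticeSAW u v, g p := ENNReal.tsum_comp_le_tsum_of_injective toLattice_injective _
    _ = tailKernel L u v := rfl

/-- CERTIFIED (positive audit of a sketch lemma): `BubbleTailDive` holds VERBATIM as typed.  From the crux's
hypothesis (B) (in its one-number normal form `criticalBubbleBound_iff_bubble_ne_top`, landed by the cdisprove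
seat of stmt-7117): far excursions force long walks (`dist ≤ 2δ|γ|`), long walks are the tail of the finite
lattice bubble `G_{x_c}(0,e)` uniformly in `(Ω, δ)` by hypothesis-free domain monotonicity and translation
invariance, and the law is the weight divided by `Z_Ω(u,v) ≥ x_c` (the edge `u ∼ v` of `Ω_δ` is a SAW).  No
junk: the only degenerate inputs (`u ∼ v` not joined, `δ ≤ 0`, unbounded `Ω`) are excluded or harmless.
[folklore] -/
theorem bubbleTailDive : BubbleTailDive := by
  intro hB ε hε
  rw [criticalBubbleBound_iff_bubble_ne_top] at hB
  have hxc : 0 < criticalFugacity := SAW.criticalFugacity_pos_lt_one'.1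
  set ε' : ℝ≥0∞ := ENNReal.ofReal ε * ENNReal.ofReal criticalFugacity with hε'
  have hε'0 : ε' ≠ 0 := by
    rw [hε']
    exact mul_ne_zero (by simpa using hε) (by simpa using hxc)
  -- the four unit vectors
  have adj_pos : ∀ i : Fin 2, (zdGraph 2).Adj 0 (Pi.single i 1) := fun i =>
    (zdGraph_adj_iff _ _).2 ⟨i, Or.inl (zero_add _).symm⟩
  have adj_neg : ∀ i : Fin 2, (zdGraph 2).Adj 0 (-Pi.single i 1) := fun i =>
    (zdGraph_adj_iff _ _).2 ⟨i, Or.inr (neg_add_cancel _).symm⟩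
  obtain ⟨L₁, hL₁⟩ := exists_tailKernel_le (hB _ (adj_pos 0)) hε'0
  obtain ⟨L₂, hL₂⟩ := exists_tailKernel_le (hB _ (adj_pos 1)) hε'0
  obtain ⟨L₃, hL₃⟩ := exists_tailKernel_le (hB _ (adj_neg 0)) hε'0
  obtain ⟨L₄, hL₄⟩ := exists_tailKernel_le (hB _ (adj_neg 1)) hε'0
  set L : ℕ := max (max L₁ L₂) (max L₃ L₄) with hL
  have hLe : ∀ e : Site 2, (zdGraph 2).Adj 0 e → tailKernel L 0 e ≤ ε' := by
    intro e he
    obtain ⟨i, hi | hi⟩ := (zdGraph_adj_iff _ _).1 he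
    · rw [zero_add] at hi
      subst hi
      fin_cases i
      · exact (tailKernel_antitone (by omega) _ _).trans hL₁
      · exact (tailKernel_antitone (by omega) _ _).trans hL₂
    · have : e = -Pi.single i 1 := eq_neg_of_add_eq_zero_left hi.symm
      subst this
      fin_cases i
      · exact (tailKernel_antitone (by omega) _ _).trans hL₃
      · exact (tailKernel_antitone (by omega) _ _).trans hL₄
  refine ⟨2 * L, fun Ω δ u v _ hδ huv => ?_⟩
  have hzd : (zdGraph 2).Adj u v := discreteDomainGraph_le_zdGraph Ω δ huv
  have he : (zdGraph 2).Adj 0 (v - u) := by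
    have := (Zd.zdGraph_adj_sub_right u v u).2 hzd
    rwa [sub_self] at this
  -- the edge SAW gives `Z_Ω(u,v) ≥ x_c`
  have hZ : ENNReal.ofReal criticalFugacity ≤ SAW.weight Ω δ u v Set.univ := by
    let γ₁ : DomainSAW Ω δ u v := ⟨SimpleGraph.Walk.cons huv SimpleGraph.Walk.nil, by
      simp [SimpleGraph.Walk.isPath_def, SimpleGraph.Walk.support, huv.ne]⟩
    calc ENNReal.ofReal criticalFugacity = SAW.weight Ω δ u v {γ₁} := by
          rw [weight_singleton]; simp [γ₁, DomainSAW.length]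
      _ ≤ SAW.weight Ω δ u v Set.univ := measure_mono (Set.subset_univ _)
  have hE : SAW.weight Ω δ u v
      {γ | ∃ z ∈ γ.walk.support, ((2 * L : ℕ) : ℝ) * δ ≤ dist (meshPoint δ z) (meshPoint δ u)} ≤ ε' :=
    ((weight_far_le_tailKernel Ω hδ u v L).trans (tailKernel_le_zero_sub L u v)).trans (hLe _ he)
  rw [SAW.law, Measure.smul_apply, smul_eq_mul]
  have hxc' : ENNReal.ofReal criticalFugacity ≠ 0 := by simpa using hxc
  calc (SAW.weight Ω δ u v Set.univ)⁻¹ * SAW.weight Ω δ u v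
        {γ | ∃ z ∈ γ.walk.support, ((2 * L : ℕ) : ℝ) * δ ≤ dist (meshPoint δ z) (meshPoint δ u)}
      ≤ (ENNReal.ofReal criticalFugacity)⁻¹ * ε' := mul_le_mul' (ENNReal.inv_le_inv.2 hZ) hE
    _ = ENNReal.ofReal ε := by
        rw [hε', mul_comm (ENNReal.ofReal ε), ← mul_assoc,
          ENNReal.inv_mul_cancel hxc' ENNReal.ofReal_ne_top, one_mul]

end Targets

end BubbleTailSection

/-! ## §9 Positive audit (cycle 3, continued): `MirrorMonotone` follows from TP₂ — certified, with the
reflection-equivariance API of the whole discretisation pipeline (`meshVertices → meshGraph → largest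
component → Ω_δ → DomainSAW → SAW.weight`) and the reversal symmetry `Z(u,v) = Z(v,u)`; reusable for every
D₄ argument of the cards. -/

section MirrorSection

open scoped BigOperators ENNReal ComplexConjugate
open Filter Set Function
open Literature.Probability.RandomPlanarGeometry.SAW
open Summit.CriticalPhenomena.SAWScalingLimit.Theorems.CriticalBubbleBound.Negative (weight_univ)

namespace Targets

/-- Verbatim copy of `Sketch.reflSite` (ideator 2): reflection of a site in the real axis, `(x, y) ↦ (x, -y)`. -/
def reflSite (v : Site 2) : Site 2 := ![v 0, -v 1]

/-- `reflSite` is an involution. [folklore] -/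
theorem reflSite_reflSite (v : Site 2) : reflSite (reflSite v) = v := by
  funext i; fin_cases i <;> simp [reflSite]

/-- `reflSite` is injective. [folklore] -/
theorem reflSite_injective : Injective reflSite := fun a b h => by
  rw [← reflSite_reflSite a, h, reflSite_reflSite]

/-- Mesh points commute with the reflection: `δ·(x,-y) = conj (δ·(x,y))`. [folklore] -/
theorem meshPoint_reflSite (δ : ℝ) (v : Site 2) : meshPoint δ (reflSite v) = conj (meshPoint δ v) := by
  apply Complex.ext
  · simp [meshPoint_re, reflSite]
  · simp [meshPoint_im, reflSite]

/-- `reflSite` is an automorphism of `ℤ²`. [folklore] -/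
theorem zdGraph_adj_reflSite {x y : Site 2} (h : (zdGraph 2).Adj x y) :
    (zdGraph 2).Adj (reflSite x) (reflSite y) := by
  rw [zdGraph_adj_iff] at h ⊢
  obtain ⟨i, h | h⟩ := h
  · subst h
    fin_cases i
    · exact ⟨0, Or.inl (by funext j; fin_cases j <;> simp [reflSite])⟩
    · exact ⟨1, Or.inr (by funext j; fin_cases j <;> simp [reflSite])⟩
  · subst h
    fin_cases i
    · exact ⟨0, Or.inr (by funext j; fin_cases j <;> simp [reflSite])⟩
    · exact ⟨1, Or.inl (by funext j; fin_cases j <;> simp [reflSite])⟩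

/-- Segments between reflected mesh points are the conjugates of the original segments. [folklore] -/
theorem segment_reflSite (δ : ℝ) (x y : Site 2) :
    segment ℝ (meshPoint δ (reflSite x)) (meshPoint δ (reflSite y)) =
      conj '' segment ℝ (meshPoint δ x) (meshPoint δ y) := by
  rw [meshPoint_reflSite, meshPoint_reflSite]
  have h := image_segment ℝ ((Complex.conjLIE : ℂ ≃ₗᵢ[ℝ] ℂ).toLinearEquiv.toLinearMap.toAffineMap)
    (meshPoint δ x) (meshPoint δ y)
  have hcoe : ⇑((Complex.conjLIE : ℂ ≃ₗᵢ[ℝ] ℂ).toLinearEquiv.toLinearMap.toAffineMap) = conj := by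
    funext z; simp
  rw [hcoe] at h
  exact h.symm

/-- A conjugation-symmetric set has a conjugation-symmetric closure. [folklore] -/
theorem conj_mem_closure {Ω : Set ℂ} (hΩ : conj '' Ω = Ω) {z : ℂ} (hz : z ∈ closure Ω) :
    conj z ∈ closure Ω := by
  have hpre : conj ⁻¹' Ω = Ω := by
    ext w
    constructor
    · intro hw
      rw [Set.mem_preimage, ← hΩ] at hw
      obtain ⟨w', hw', he⟩ := hw
      have : w' = w := by
        have := congrArg conj he
        simpa using this
      exact this ▸ hw'
    · intro hw
      rw [Set.mem_preimage, ← hΩ]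
      exact ⟨w, hw, rfl⟩
  have hsub := Complex.continuous_conj.closure_preimage_subset Ω
  rw [hpre] at hsub
  exact hsub hz

/-- Mesh vertices are reflection-symmetric for a conjugation-symmetric domain. [folklore] -/
theorem reflSite_mem_meshVertices {Ω : Set ℂ} (hΩ : conj '' Ω = Ω) {δ : ℝ} {x : Site 2}
    (hx : x ∈ meshVertices Ω δ) : reflSite x ∈ meshVertices Ω δ := by
  rw [mem_meshVertices_iff, meshPoint_reflSite, ← hΩ]
  exact ⟨_, hx, rfl⟩

/-- The mesh graph is reflection-symmetric for a conjugation-symmetric domain. [folklore] -/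
theorem meshGraph_adj_reflSite {Ω : Set ℂ} (hΩ : conj '' Ω = Ω) {δ : ℝ} {x y : Site 2}
    (h : (meshGraph Ω δ).Adj x y) : (meshGraph Ω δ).Adj (reflSite x) (reflSite y) := by
  rw [meshGraph_adj_iff] at h ⊢
  refine ⟨zdGraph_adj_reflSite h.1, ?_⟩
  rw [segment_reflSite]
  rintro _ ⟨z, hz, rfl⟩
  exact conj_mem_closure hΩ (h.2 hz)

/-- The reflection as a permutation of the mesh vertices. -/
def reflEquivVert {Ω : Set ℂ} (hΩ : conj '' Ω = Ω) (δ : ℝ) : meshVertices Ω δ ≃ meshVertices Ω δ where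
  toFun v := ⟨reflSite v.1, reflSite_mem_meshVertices hΩ v.2⟩
  invFun v := ⟨reflSite v.1, reflSite_mem_meshVertices hΩ v.2⟩
  left_inv v := Subtype.ext (reflSite_reflSite v.1)
  right_inv v := Subtype.ext (reflSite_reflSite v.1)

/-- The reflection as an automorphism of the mesh vertex graph. -/
def reflIsoVert {Ω : Set ℂ} (hΩ : conj '' Ω = Ω) (δ : ℝ) : meshVertexGraph Ω δ ≃g meshVertexGraph Ω δ where
  toEquiv := reflEquivVert hΩ δ
  map_rel_iff' := by
    intro a b
    simp only [SimpleGraph.comap_adj, Function.Embedding.subtype_apply]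
    constructor
    · intro h
      have := meshGraph_adj_reflSite hΩ h
      simpa [reflEquivVert, reflSite_reflSite] using this
    · intro h
      exact meshGraph_adj_reflSite hΩ h

/-- The discrete domain `Ω_δ` (largest-component convention included) is reflection-symmetric for a
conjugation-symmetric domain. [folklore] -/
theorem reflSite_mem_meshDomain {Ω : Set ℂ} (hΩ : conj '' Ω = Ω) {δ : ℝ} {x : Site 2}
    (hx : x ∈ meshDomain Ω δ) : reflSite x ∈ meshDomain Ω δ := by
  simp only [meshDomain, Set.mem_iUnion, Set.mem_image] at hx ⊢
  obtain ⟨C, hCmax, v, hv, rfl⟩ := hx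
  set φ := reflIsoVert hΩ δ with hφ
  have hcard : ∀ C : (meshVertexGraph Ω δ).ConnectedComponent,
      (φ.connectedComponentEquiv C).supp.ncard = C.supp.ncard := by
    intro C
    rw [← Nat.card_coe_set_eq, ← Nat.card_coe_set_eq]
    exact Nat.card_congr (SimpleGraph.ConnectedComponent.isoEquivSupp φ C).symm
  refine ⟨φ.connectedComponentEquiv C, fun C' => ?_,
    ⟨(SimpleGraph.ConnectedComponent.isoEquivSupp φ C ⟨v, hv⟩).1,
      (SimpleGraph.ConnectedComponent.isoEquivSupp φ C ⟨v, hv⟩).2, rfl⟩⟩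
  have h1 := hCmax (φ.connectedComponentEquiv.symm C')
  have h2 := hcard (φ.connectedComponentEquiv.symm C')
  rw [Equiv.apply_symm_apply] at h2
  rw [h2, hcard]
  exact h1

/-- The graph `Ω_δ` is reflection-symmetric for a conjugation-symmetric domain. [folklore] -/
theorem discreteDomainGraph_adj_reflSite {Ω : Set ℂ} (hΩ : conj '' Ω = Ω) {δ : ℝ} {x y : Site 2}
    (h : (discreteDomainGraph Ω δ).Adj x y) :
    (discreteDomainGraph Ω δ).Adj (reflSite x) (reflSite y) := by
  rw [discreteDomainGraph_adj_iff] at h ⊢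
  exact ⟨meshGraph_adj_reflSite hΩ h.1, reflSite_mem_meshDomain hΩ h.2.1, reflSite_mem_meshDomain hΩ h.2.2⟩

/-- The reflection as a graph homomorphism of `Ω_δ`. -/
def reflHom {Ω : Set ℂ} (hΩ : conj '' Ω = Ω) (δ : ℝ) : discreteDomainGraph Ω δ →g discreteDomainGraph Ω δ where
  toFun := reflSite
  map_rel' := discreteDomainGraph_adj_reflSite hΩ

/-- Reflection equivariance of the critical kernel, one inequality. [folklore] -/
theorem weight_univ_le_reflSite {Ω : Set ℂ} (hΩ : conj '' Ω = Ω) (δ : ℝ) (u v : Site 2) :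
    SAW.weight Ω δ u v Set.univ ≤ SAW.weight Ω δ (reflSite u) (reflSite v) Set.univ := by
  rw [weight_univ, weight_univ]
  let F : DomainSAW Ω δ u v → DomainSAW Ω δ (reflSite u) (reflSite v) := fun γ =>
    ⟨γ.walk.map (reflHom hΩ δ), γ.isPath.map reflSite_injective⟩
  have hF : Injective F := by
    rintro ⟨p, hp⟩ ⟨q, hq⟩ h
    have h' : p.map (reflHom hΩ δ) = q.map (reflHom hΩ δ) := congrArg DomainSAW.walk h
    have := SimpleGraph.Walk.map_injective_of_injective (f := reflHom hΩ δ) reflSite_injective u v h'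
    subst this
    rfl
  have key : (fun γ : DomainSAW Ω δ u v => ENNReal.ofReal (criticalFugacity ^ γ.length)) =
      fun γ => (fun γ' : DomainSAW Ω δ (reflSite u) (reflSite v) =>
        ENNReal.ofReal (criticalFugacity ^ γ'.length)) (F γ) := by
    funext γ
    exact congrArg (fun n : ℕ => ENNReal.ofReal (criticalFugacity ^ n))
      (SimpleGraph.Walk.length_map _ _).symm
  rw [key]
  exact ENNReal.tsum_comp_le_tsum_of_injective hF _

/-- **Reflection equivariance** of the critical kernel: `Z(ū, v̄) = Z(u, v)` when `conj Ω = Ω`. [folklore] -/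
theorem weight_univ_reflSite {Ω : Set ℂ} (hΩ : conj '' Ω = Ω) (δ : ℝ) (u v : Site 2) :
    SAW.weight Ω δ (reflSite u) (reflSite v) Set.univ = SAW.weight Ω δ u v Set.univ := by
  refine le_antisymm ?_ (weight_univ_le_reflSite hΩ δ u v)
  have h := weight_univ_le_reflSite hΩ δ (reflSite u) (reflSite v)
  rwa [reflSite_reflSite, reflSite_reflSite] at h

/-- Reversal symmetry of the critical kernel, one inequality. [folklore] -/
theorem weight_univ_le_reverse (Ω : Set ℂ) (δ : ℝ) (u v : Site 2) :
    SAW.weight Ω δ u v Set.univ ≤ SAW.weight Ω δ v u Set.univ := by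
  rw [weight_univ, weight_univ]
  let F : DomainSAW Ω δ u v → DomainSAW Ω δ v u := fun γ => ⟨γ.walk.reverse, γ.isPath.reverse⟩
  have hF : Injective F := by
    rintro ⟨p, hp⟩ ⟨q, hq⟩ h
    have h' : p.reverse = q.reverse := congrArg DomainSAW.walk h
    have h'' := congrArg SimpleGraph.Walk.reverse h'
    rw [SimpleGraph.Walk.reverse_reverse, SimpleGraph.Walk.reverse_reverse] at h''
    subst h''
    rfl
  have key : (fun γ : DomainSAW Ω δ u v => ENNReal.ofReal (criticalFugacity ^ γ.length)) =
      fun γ => (fun γ' : DomainSAW Ω δ v u => ENNReal.ofReal (criticalFugacity ^ γ'.length)) (F γ) := by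
    funext γ
    exact congrArg (fun n : ℕ => ENNReal.ofReal (criticalFugacity ^ n))
      (SimpleGraph.Walk.length_reverse _).symm
  rw [key]
  exact ENNReal.tsum_comp_le_tsum_of_injective hF _

/-- **Reversal symmetry** of the critical kernel: `Z(u, v) = Z(v, u)`. [folklore] -/
theorem weight_univ_symm (Ω : Set ℂ) (δ : ℝ) (u v : Site 2) :
    SAW.weight Ω δ u v Set.univ = SAW.weight Ω δ v u Set.univ :=
  le_antisymm (weight_univ_le_reverse Ω δ u v) (weight_univ_le_reverse Ω δ v u)

/-- CERTIFIED (positive audit of a sketch lemma): `Sketch.MirrorMonotone` (ideator 2, card `mirror-monotone-decay`;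
its hypotheses, binders and conclusion are reproduced VERBATIM, so
`fun hTP Ω δ m t => mirrorMonotone hTP Ω δ m t` inhabits the sketch `Prop`) holds: TP₂ at the cyclic quadruple
`(m, t, t̄, m̄)` gives `Z(m,t̄)·Z(t,m̄) ≤ Z(m,t)·Z(t̄,m̄)`; reflection equivariance (`weight_univ_reflSite`, which
needs the symmetry of the WHOLE discretisation pipeline `meshVertices → meshGraph → largest component → Ω_δ`)
and reversal (`weight_univ_symm`) turn this into `Z(m,t̄)² ≤ Z(m,t)²`.  The typed provisos are exactly
`BoundaryTP2`'s with `(p₁,p₂,p₃,p₄) = (m, t, t̄, m̄)`. [folklore] -/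
theorem mirrorMonotone (hTP : BoundaryTP2) (Ω : Set ℂ) (δ : ℝ) (m t : Site 2)
    (hB : Bornology.IsBounded Ω) (hS : SimplyConnectedSpace Ω) (hδ : 0 < δ)
    (hΩ : (starRingEnd ℂ) '' Ω = Ω)
    (h1 : ∀ (P : SAW.DomainSAW Ω δ m (reflSite t)) (Q : SAW.DomainSAW Ω δ t (reflSite m)),
        ∃ v, v ∈ P.walk.support ∧ v ∈ Q.walk.support)
    (h2 : ∃ (P : SAW.DomainSAW Ω δ m t) (Q : SAW.DomainSAW Ω δ (reflSite t) (reflSite m)),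
        List.Disjoint P.walk.support Q.walk.support)
    (h3 : ∃ (P : SAW.DomainSAW Ω δ m (reflSite m)) (Q : SAW.DomainSAW Ω δ t (reflSite t)),
        List.Disjoint P.walk.support Q.walk.support) :
    SAW.weight Ω δ m (reflSite t) Set.univ ≤ SAW.weight Ω δ m t Set.univ := by
  have key := hTP Ω δ m t (reflSite t) (reflSite m) hB hS hδ h1 h2 h3
  have e1 : SAW.weight Ω δ t (reflSite m) Set.univ = SAW.weight Ω δ m (reflSite t) Set.univ := by
    rw [← weight_univ_reflSite hΩ δ t (reflSite m), reflSite_reflSite, weight_univ_symm]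
  have e2 : SAW.weight Ω δ (reflSite t) (reflSite m) Set.univ = SAW.weight Ω δ m t Set.univ := by
    rw [weight_univ_reflSite hΩ, weight_univ_symm]
  rw [e1, e2] at key
  by_contra hlt
  exact absurd key (not_le.2 (ENNReal.mul_lt_mul (not_le.1 hlt) (not_le.1 hlt)))

end Targets

end MirrorSection

/-! ## §10 Targets (cycle 4): the five registered stubs of the PICKED line `radial-portal-transfer` — audit

Line `Cruxes/TPToTraversalBound/Lines/radial-portal-transfer.lean` (PICKED.md, 2026-08-16T01:43Z): stubs
`stub_cleanContraction : CleanContraction`, `stub_decorationRemoval : BoundaryTP2 → CriticalBubbleBound →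
CleanContraction → HeavinessContraction`, `stub_topHeaviness : TopHeaviness`, `stub_chain : HeavinessContraction →
TopHeaviness → InteriorShellBound`, `stub_boundaryShells : BoundaryShellBound`; composition
`traversalBound_of_shellBounds` proved there.  The vocabulary (`supDist`, `InOpenBox`, `closedBox`, `outEdgeSet`,
`IsOutsidePiece`, `HasPieces`) and the three analytic statements are copied VERBATIM below (namespace
`Targets.RadialPortalTransfer`) and a small API is certified.  RESULT OF THE ATTACK: no stub is refuted; none is
junk; here is why, stub by stub (numbers, not adjectives).

* **Junk audit of the vocabulary (certified below).** `HasPieces γ c N d 0` is `True` (`hasPieces_zero`), so at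
  `j = 0` the contraction inequalities read `law(atom) ≤ C · law(atom)`: a witness has `C ≥ 1` or `m₀ ≥ 1` — harmless.
  `HasPieces` is antitone in the count and in the bigness threshold (`HasPieces.of_le`, `HasPieces.anti_threshold`),
  so `h_l := max {m | HasPieces γ c N_l N_l m}` is well defined and `{h ≥ j}` is the typed event; the count is
  `≤ |γ| + 1` (`HasPieces.le_length_succ`) and at `u = v` (only the trivial SAW) no big piece exists
  (`not_hasPieces_self`), so every statement is vacuous-but-true there.  Maximal pieces other than the initial one
  START ON THE RING `supDist = N` (`IsOutsidePiece.supDist_start_eq`: one lattice step changes `supDist` by ≤ 1,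
  `supDist_le_of_adj`), whence at most `8N + 1` pieces: for every FIXED `N` the inequalities of
  `CleanContraction` / `HeavinessContraction` / `TopHeaviness` are absorbed by the constant (`C ≥ 2^{λ(8N+1)}`,
  resp. `C ≥ e^{c₁(8N+1)}`); only the `N → ∞` uniformity has content, exactly as the line card says.  Within an atom
  `{outEdgeSet γ = outEdgeSet γ₀}` the SET of outside paths is rigid (an interior vertex of an outside path has
  both its walk-edges in the set; a boundary-ring vertex has exactly one neighbour in the open box, so no
  edgeless outside visit exists except `u`/`v` themselves): what varies is the ORDER and ORIENTATION in which the
  walk threads the outside paths, and the inside routing — i.e. the atom is a genuine multi-strand system in the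
  clean box with combinatorial portal data, as the card claims.  `law` normalisation cancels on both sides
  (`law = 0` when `weight univ ∈ {0, ⊤}`).  Ω may be ANY bounded set containing the closed box (F5 loophole: the
  outside graph is an arbitrary finite subgraph of ℤ², holes allowed) — immaterial, the inside is clean.
* **F11 — the forced-onion attack on `CleanContraction` / `HeavinessContraction` FAILS COMBINATORIALLY.**  The only
  probability-one mechanism by which outside data could force `≥ j` big `N`-pieces is planarity: portals in cyclic
  order on the box boundary, outside pairing `σ` (non-crossing), inside pairing `M` (non-crossing), `M ∪ σ` a single
  Hamiltonian path; an inside arc enters the `N`-box only if it lies at nesting depth `≥ 3N+1` above a central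
  column (each enclosing arc crosses the column of the innermost arc at a distinct row), and `≥ 6N + J` arcs
  separating bottom-mid from top-mid would force `≥ J + 1` entries (column `0` has `8N-1` rows, `2N-1` of them in the
  `N`-box).  Exhaustive enumeration (this seat, `exp/meander_force2.py`, `meander_force3.py`; T = number of portals
  ≤ 16: all 6,435 outside pairings × 1,430 inside pairings at T = 16, every position of the two end-portals, every
  base gap and every antipodal cut; T = 18: all 24,310 outside pairings, every base gap, against the 256 block tilings
  of depth ≤ 2 — 0 failures): FOR EVERY outside pairing there is an admissible inside pairing of nesting
  depth ≤ 2 and one with ≤ 2 cut-crossing arcs.  So no outside data — small ("decorations", sup-diameter < 2N,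
  unlimited in number) or big — force a single entry into the inner box; the shallow completion (span-1 arcs along
  the boundary layer, one comb level) always exists and is lattice-realisable.  Hence ¬`HeavinessContraction`
  cannot be certified by a deterministic witness; the stubs are purely probabilistic (whether the conditioned
  multi-strand system PREFERS shallow completions), i.e. KS-G2-type statements, open in print (cycle-2/3 literature
  sweeps: nothing on annulus crossing / RSW / (H1) for the critical planar SAW).  The planner's "ratio 4 because a
  caged onion of small pieces has ≤ 2N layers" is therefore not even needed for soundness against forcing.
* **`CleanContraction` / `HeavinessContraction` — regimes checked.** (i) `m` large: `h_N ≤ 8N+1`, so for `θ > 1/2`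
  and `m ≥ 16N+2` the range `j ≥ θ m` is empty; the binding regime is `m ≲ 8N/θ`. (ii) "Packed" or serial crossing
  reference walks (a boustrophedon `γ₀` through all `8N-1` rows, big or small outside loops) FORCE NOTHING: by F11 the
  atom always contains the shallow threading (left hairpins up the left layer, one top traverse, right hairpins,
  `h_N ≤ 1`), so no lower bound on `θ` is certifiable by forcing; for the full boustrophedon the shallow threading
  even DOMINATES (`≈ Z_adj^{8N}` against `x_c^{Θ(N²)}` for the straight rows).  Whether `θ > 0` is needed at all is
  open: F11 shows that ≤ 2 long (cut-crossing) inside arcs always suffice combinatorially, and short same-side arcs are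
  favoured energetically (boundary two-point decay `∝ dist^{-5/4}`), so the typical heaviness may well be `O(1)`
  UNIFORMLY in the data — the `θ = 0` form suggested by the drefute seat (evidence note 2026-08-16) is plausible and
  the `θ m` allowance only weakens (hence protects) the stub; the planner's picture "m strands forced THROUGH the box,
  a θ-fraction reaches the quarter-box" does not describe the conditioned ensemble, whose portal pairing is free. (iii) sparse data `m ≪ N`: divers
  ≈ Binomial(m, p(4)), so `P(h ≥ θ m + m₀) ≤ e^{-c m}` is absorbed by a small `λ`. (iv) `u` and/or `v` inside the
  box (even `u = c`): one forced exit, nothing more. (v) `u = v`: trivial SAW only.  No regime contradicts the typed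
  inequality; a genuine test needs conditioned multi-strand Monte Carlo at `N ≳ 8`, beyond this seat's means, and
  could only pin `θ` (possibly `θ* = 0`, see (ii)).
* **`TopHeaviness` — checked.** `m = 0` needs `C ≥ 1`; `m > 8N+1` is empty; fixed `N` absorbed; the content is
  `sup_{boxes, N, m} e^{c₁ m} P(h_N ≥ m) < ∞` in the FIXED `(D,a,b)`.  The clean region is the DISC of radius `4Nδ`
  (it contains the sup-box of half-side `2√2·N`, not the `4N`-box) — immaterial for `stub_chain`, which uses it only
  at the top level where `4N₀δ ≤ R/2`.  Deep-start boxes (§6: `ball (a_δ) √δ ⊆ D`) centred AT the start are in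
  scope: `h ≥ m` = `m-1` returns to the start box after excursions ≥ N/2, each an O(1)-cost event at fixed ratio
  (whole-plane endpoint picture below scale √δ, boundary picture above) — exponential in `m` is the prediction;
  `m ≍ N` forces ≍ N² steps in an N-box (Hamiltonian-type cost `e^{-cN²} ≪ e^{-c₁N}`).  Consistent; one-scale
  G2-strength; not refutable here.
* **`stub_chain` — bookkeeping verified on paper, no mis-typing found.** `outEdgeSet(·, N_l)` is the function
  `{e ∈ outEdgeSet(·, N_{l+1}) | both ends at supDist ≥ N_l}` of the finer level (filtration ✓); `h_l` is a function
  of `outEdgeSet(·, N_l)` (big pieces have edges ✓); `HeavinessContraction` at `(4N, N) = (N_l, N_{l+1})` is exactly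
  the one-step kernel bound with bigness thresholds `N_l/2`, `N_{l+1}/2` ✓; box inclusions: `closedBox δ c N₀`
  (circumradius `√2 N₀ δ ≤ √2 R/8`) and `closedBall (δc) (4N₀δ)` (`≤ R/2 + δ`) both inside `closedBall x R` for
  `16ρ ≤ R`, `δ ≤ ρ` ✓; conversion: each traversal segment `[s,t]` of the polyline contains a lattice vertex within
  sup-distance `ρ + 3δ/2 < N_L δ` of `δc` (`N_L = ⌈ρ/δ⌉ + 2`) and one at sup-distance `≥ (R-2δ)/√2 > 1.5 N_l δ + N_l δ`,
  far vertices of traversals `i`, `i+2` are separated in walk order by the near vertex of traversal `i+1`, and the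
  initial/final pieces are big too (their ring endpoint is at sup-distance `N_l`) ⇒ `h_l ≥ ⌈k/2⌉` for all `l ≤ L` ✓;
  supermartingale `E[2^{μh_{l+1}} | atom, h_l = m] ≤ C' 2^{μ(θm+m₀)}` (μ < λ₀) ⇒ `ζ = C'2^{μm₀}2^{-μ(1-θ)k'} → 0` ✓.
  Provable as typed (XL).
* **`BoundaryShellBound` / `InteriorShellBound` — checked.** Both are (H1) restricted to a shell class with EVERY
  exponent `λ` but a shell-dependent threshold `k(x,ρ,R)` chosen after `λ`: consistent with the quadratic growth of
  boundary / bulk / endpoint multi-arm exponents (`x_L = (9L²-4)/48`: near the deep start `k = 7` already gives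
  exponent `x₇ - x₁ = 9 > 6`), with F2(iii) (`traversalBound_iff_threshold_ge`: forced crossings absorbed) and F3
  (constants per `(D,a,b)`).  `x ∉ closure D`: empty events or re-centring.  Not refutable without ¬(H1).
* **Other lines (not picked).** The lead's paper witness against `power-law-tp2`'s seed `TP2Gap` AS TYPED (cycle
  graph `Ω_δ` through the F5 loophole: crossing/nested `≥ 1 - x^{d-a-b-c} → 1`) is correct (recomputed:
  `Z₁₃Z₂₄ - Z₁₄Z₂₃ = -x^{b+d}(1-x^{2a})(1-x^{2c})`, `Z₁₄Z₂₃ ≥ x^{a+2b+c}`); class misstated (repair: hole-free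
  `Ω_δ`), and in the repaired class the bottleneck/rank-one mechanism is excluded by `JoinedBeyond` (two rooms joined
  only through the mouth cannot join `p₄,p₁` far from it without a second corridor = a hole).  Not certified in Lean
  (parametric cycle domains; low value after the pick). -/

section RadialPortalSection

open MeasureTheory Filter Topology Set Metric
open scoped NNReal ENNReal
open Literature.Probability.RandomPlanarGeometry.SAW

namespace Targets

namespace RadialPortalTransfer

/-- Verbatim copy (line `radial-portal-transfer`): sup-norm distance on `ℤ²` (lattice units). -/
def supDist (p q : Site 2) : ℤ := max |p 0 - q 0| |p 1 - q 1|

/-- Verbatim copy: `v` lies in the OPEN lattice box of half-side `N` about `c`. -/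
def InOpenBox (c : Site 2) (N : ℕ) (v : Site 2) : Prop := supDist v c < N

/-- Verbatim copy: the closed planar square of half-side `N δ` about the mesh point of `c`. -/
def closedBox (δ : ℝ) (c : Site 2) (N : ℕ) : Set ℂ :=
  {z | |z.re - (meshPoint δ c).re| ≤ N * δ ∧ |z.im - (meshPoint δ c).im| ≤ N * δ}

variable {Ω : Set ℂ} {δ : ℝ} {u v : Site 2}

/-- Verbatim copy: the OUTSIDE CONFIGURATION of a SAW relative to the box `(c, N)`. -/
def outEdgeSet (γ : DomainSAW Ω δ u v) (c : Site 2) (N : ℕ) : Set (Sym2 (Site 2)) :=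
  {e | e ∈ γ.walk.edges ∧ ∀ w ∈ e, ¬ InOpenBox c N w}

/-- Verbatim copy: `[i, j]` is a MAXIMAL PIECE of the walk OUTSIDE the open box `(c, N)`. -/
def IsOutsidePiece (γ : DomainSAW Ω δ u v) (c : Site 2) (N i j : ℕ) : Prop :=
  i ≤ j ∧ j ≤ γ.walk.length ∧ (∀ t, i ≤ t → t ≤ j → ¬ InOpenBox c N (γ.walk.getVert t)) ∧
    (i = 0 ∨ InOpenBox c N (γ.walk.getVert (i - 1))) ∧
    (j = γ.walk.length ∨ InOpenBox c N (γ.walk.getVert (j + 1)))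

/-- Verbatim copy: HEAVINESS COUNT — at least `m` distinct maximal outside pieces, each of sup-diameter `≥ d/2`. -/
def HasPieces (γ : DomainSAW Ω δ u v) (c : Site 2) (N d m : ℕ) : Prop :=
  ∃ i j : Fin m → ℕ, StrictMono i ∧ ∀ k, IsOutsidePiece γ c N (i k) (j k) ∧
    ∃ t t', i k ≤ t ∧ t ≤ j k ∧ i k ≤ t' ∧ t' ≤ j k ∧
      (d : ℤ) ≤ 2 * supDist (γ.walk.getVert t) (γ.walk.getVert t')

/-- Verbatim copy of the line's `CleanContraction` (stub 1). -/
def CleanContraction : Prop :=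
  ∃ (θ lam C : ℝ) (m₀ : ℕ), θ < 1 ∧ 0 < lam ∧
    ∀ (Ω : Set ℂ) (δ : ℝ) (u v c : Site 2) (N m j : ℕ) (γ₀ : DomainSAW Ω δ u v),
      Bornology.IsBounded Ω → 0 < δ → 1 ≤ N → closedBox δ c (4 * N) ⊆ Ω →
      ¬ HasPieces γ₀ c (4 * N) 0 (m + 1) → θ * m + m₀ ≤ (j : ℝ) →
      law Ω δ u v {γ | outEdgeSet γ c (4 * N) = outEdgeSet γ₀ c (4 * N) ∧ HasPieces γ c N N j}
        ≤ ENNReal.ofReal (C * 2 ^ (-(lam * j))) *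
          law Ω δ u v {γ | outEdgeSet γ c (4 * N) = outEdgeSet γ₀ c (4 * N)}

/-- Verbatim copy of the line's `HeavinessContraction` (output of stub 2, input of stub 4). -/
def HeavinessContraction : Prop :=
  ∃ (θ lam C : ℝ) (m₀ : ℕ), θ < 1 ∧ 0 < lam ∧
    ∀ (Ω : Set ℂ) (δ : ℝ) (u v c : Site 2) (N m j : ℕ) (γ₀ : DomainSAW Ω δ u v),
      Bornology.IsBounded Ω → 0 < δ → 1 ≤ N → closedBox δ c (4 * N) ⊆ Ω →
      ¬ HasPieces γ₀ c (4 * N) (4 * N) (m + 1) → θ * m + m₀ ≤ (j : ℝ) →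
      law Ω δ u v {γ | outEdgeSet γ c (4 * N) = outEdgeSet γ₀ c (4 * N) ∧ HasPieces γ c N N j}
        ≤ ENNReal.ofReal (C * 2 ^ (-(lam * j))) *
          law Ω δ u v {γ | outEdgeSet γ c (4 * N) = outEdgeSet γ₀ c (4 * N)}

/-- Verbatim copy of the line's `TopHeaviness` (stub 3). -/
def TopHeaviness : Prop :=
  ∀ (D : DobrushinDomain) (a b : ℝ → Site 2), IsEndpointApprox D a b →
    ∃ (C c₁ δ₀ : ℝ), 0 < c₁ ∧ 0 < δ₀ ∧ ∀ δ ∈ Set.Ioc (0 : ℝ) δ₀, ∀ (c : Site 2) (N m : ℕ),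
      1 ≤ N → Metric.closedBall (meshPoint δ c) (4 * N * δ) ⊆ D.carrier →
        law D.carrier δ (a δ) (b δ) {γ | HasPieces γ c N N m}
          ≤ ENNReal.ofReal (C * Real.exp (-(c₁ * m)))

/-! ### Certified API of the heaviness count -/

/-- Zero pieces is `True`: at `j = 0` / `m = 0` the contraction and top-state inequalities only say `C ≥ 1`
(when `m₀ = 0`). [folklore] -/
theorem hasPieces_zero (γ : DomainSAW Ω δ u v) (c : Site 2) (N d : ℕ) : HasPieces γ c N d 0 := by
  refine ⟨Fin.elim0, Fin.elim0, ?_, ?_⟩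
  · intro a; exact a.elim0
  · intro k; exact k.elim0

/-- The heaviness event is antitone in the count: `{h ≥ k} ⊆ {h ≥ j}` for `j ≤ k`. [folklore] -/
theorem HasPieces.of_le {γ : DomainSAW Ω δ u v} {c : Site 2} {N d j k : ℕ} (h : HasPieces γ c N d k)
    (hjk : j ≤ k) : HasPieces γ c N d j := by
  obtain ⟨i, i', hi, hk⟩ := h
  exact ⟨i ∘ Fin.castLE hjk, i' ∘ Fin.castLE hjk, hi.comp (Fin.strictMono_castLE hjk), fun a => hk _⟩

/-- The heaviness event is antitone in the bigness threshold: big pieces are pieces. [folklore] -/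
theorem HasPieces.anti_threshold {γ : DomainSAW Ω δ u v} {c : Site 2} {N d d' m : ℕ}
    (h : HasPieces γ c N d m) (hd : d' ≤ d) : HasPieces γ c N d' m := by
  obtain ⟨i, i', hi, hk⟩ := h
  refine ⟨i, i', hi, fun a => ⟨(hk a).1, ?_⟩⟩
  obtain ⟨t, t', h1, h2, h3, h4, h5⟩ := (hk a).2
  exact ⟨t, t', h1, h2, h3, h4, le_trans (by exact_mod_cast hd) h5⟩

/-- The pieces have pairwise distinct starts in `[0, |γ|]`, so there are at most `|γ| + 1` of them (the state space
of `h` is finite on every SAW). [folklore] -/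
theorem HasPieces.le_length_succ {γ : DomainSAW Ω δ u v} {c : Site 2} {N d m : ℕ} (h : HasPieces γ c N d m) :
    m ≤ γ.walk.length + 1 := by
  obtain ⟨i, i', hi, hk⟩ := h
  let f : Fin m → Fin (γ.walk.length + 1) := fun a =>
    ⟨i a, Nat.lt_succ_of_le (le_trans (hk a).1.1 (hk a).1.2.1)⟩
  have hf : Function.Injective f := by
    intro a b hab
    apply hi.injective
    have := congrArg Fin.val hab
    simpa [f] using this
  simpa using Fintype.card_le_of_injective f hf

/-- At `u = v` the only SAW is the trivial one and it has no piece of positive sup-diameter: every typed statement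
of the line is vacuous-but-true on the diagonal. [folklore] -/
theorem not_hasPieces_self (γ : DomainSAW Ω δ u u) (c : Site 2) {N d : ℕ} (hd : 1 ≤ d) :
    ¬ HasPieces γ c N d 1 := by
  rintro ⟨i, i', -, hk⟩
  obtain ⟨⟨hij, hjl, -⟩, t, t', h1, h2, h3, h4, h5⟩ := hk 0
  have hlen : γ.walk.length = 0 :=
    SimpleGraph.Walk.length_eq_zero_iff.2 (SimpleGraph.Walk.isPath_iff_nil.1 γ.isPath)
  have ht : t = t' := by omega
  subst ht
  have h0 : supDist (γ.walk.getVert t) (γ.walk.getVert t) = 0 := by simp [supDist]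
  rw [h0] at h5
  have : (1 : ℤ) ≤ d := by exact_mod_cast hd
  omega

/-- One lattice step changes the sup-norm distance to any centre by at most one. [folklore] -/
theorem supDist_le_of_adj {x y : Site 2} (h : (zdGraph 2).Adj x y) (c : Site 2) :
    supDist y c ≤ supDist x c + 1 := by
  have key : ∀ k : Fin 2, |y k - c k| ≤ |x k - c k| + 1 := by
    intro k
    obtain ⟨i, hxy | hxy⟩ := (zdGraph_adj_iff x y).1 h
    · subst hxy
      rw [Pi.add_apply, Pi.single_apply]
      split_ifs
      · calc |x k + 1 - c k| = |(x k - c k) + 1| := by ring_nf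
          _ ≤ |x k - c k| + |(1 : ℤ)| := abs_add_le _ _
          _ = |x k - c k| + 1 := by simp
      · simp
    · subst hxy
      rw [Pi.add_apply, Pi.single_apply]
      split_ifs
      · calc |y k - c k| = |(y k + 1 - c k) + (-1)| := by ring_nf
          _ ≤ |y k + 1 - c k| + |(-1 : ℤ)| := abs_add_le _ _
          _ = |y k + 1 - c k| + 1 := by simp
      · simp
  unfold supDist
  refine max_le ((key 0).trans ?_) ((key 1).trans ?_)
  · gcongr; exact le_max_left _ _
  · gcongr; exact le_max_right _ _

/-- **Pieces start on the ring.**  A maximal outside piece that is not the initial one starts at sup-distance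
EXACTLY `N` from the centre (its predecessor is in the open box, one lattice step away).  Hence distinct pieces
occupy distinct sites of the ring `{supDist = N}` (`8N` sites), `h ≤ 8N + 1`, and every FIXED `N` of the line's three
analytic statements is absorbed by their constants — only `N → ∞` has content. [folklore] -/
theorem IsOutsidePiece.supDist_start_eq {γ : DomainSAW Ω δ u v} {c : Site 2} {N i j : ℕ}
    (h : IsOutsidePiece γ c N i j) (hi : i ≠ 0) : supDist (γ.walk.getVert i) c = N := by
  obtain ⟨hij, hjl, hout, hstart, -⟩ := h
  have hin : InOpenBox c N (γ.walk.getVert (i - 1)) := hstart.resolve_left hi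
  have hout_i : ¬ InOpenBox c N (γ.walk.getVert i) := hout i le_rfl hij
  have hlt : i - 1 < γ.walk.length := by omega
  have hadj := γ.walk.adj_getVert_succ hlt
  rw [show i - 1 + 1 = i by omega] at hadj
  have hzd : (zdGraph 2).Adj (γ.walk.getVert (i - 1)) (γ.walk.getVert i) :=
    discreteDomainGraph_le_zdGraph Ω δ hadj
  have hstep := supDist_le_of_adj hzd c
  unfold InOpenBox at hin hout_i
  push Not at hout_i
  omega

end RadialPortalTransfer

end Targets

end RadialPortalSection


end Summit.CriticalPhenomena.SAWScalingLimit.Cruxes.TPToTraversalBound.Disproof
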